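import Literature.MathematicalPhysics.QuantumFieldTheory.Balaban1983to89.B13NodeTorusKernel216
import Literature.MathematicalPhysics.QuantumFieldTheory.Balaban1983to89.NodeOKernel216
import Literature.MathematicalPhysics.QuantumFieldTheory.Balaban1983to89.NodeOLettersOfWalksAcross

/-!
# `Balaban1983to89.B13NodeTorusWalks` — T. Bałaban, *Renormalization group approach to lattice gauge field theories.
II. Cluster expansions*, Commun. Math. Phys. **116** (1988) 1–22 [Balaban1988RG2Cluster], Lemmas 1–3 (pp. 9, 11, 20):
**the B13 leaf triple `Lemma1Printed ∧ Lemma2Printed ∧ Lemma3Printed` of node N10 (`Dag.B13_main`) ON THE TWO-SCALE TORUS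
WITH LEMMA 3's KERNEL INPUTS DISCHARGED FROM THE W-WALKS RUNG** — the per-term (2.16)-level records L17a ∕ L16a of
`B13NodeTorusKernel216.b13Leaf_twoTorus_kernel216` are no longer hypotheses: they are READ OFF one sixteen-constant
package `q` of joint walk expansions ([Balaban1985BackgroundPropagators] Thm 3.10 shape) carried by the (2.14)-terms'
kernel data (`NodeOLettersOfWalksAcross.TermWalks` per term, resp. `UniformWalksAcross 𝓣 q` across a family), by name.

statement-level bookkeeping over published theorems with citation tags; kernel-checked compositions of tree theorems;
nothing here is a claim about the Yang–Mills mass gap.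

Cell `pub-ymgap`, HUMAN RULING D-0062 Track A, DAG node N10 = [B13]; R134 acceleration seat `pub-ymgap-dag-n10-c`,
FAN-OUT v1.1 §N10 row s3 («located caveat admitted as hypothesis: `B13_main` ∕ the b13 triple FROM the displayed
hypothesis `UniformWalksAcross 𝓣 q`, ∀-generic over `𝓣`»).  A NEW LEAF over `B13NodeTorusKernel216` (n10-a, p417989),
`NodeOKernel216` (memo cell ym-nodeO), `NodeOLettersOfWalksAcross` (n10-b, p443891); nothing there modified.

WHY.  After n10-a∕n10-b (27 modules) every [B13]-internal display of Lemmas 1–3 is a torus theorem, and the (B1)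
chain is complete BY NAME down to ONE Prop — but in FOUR files whose junction was never written as one theorem:
`TermWalks 𝒦 q` ⟹ (`NodeOLettersOfWalksAcross.termLetters_of_termWalks`) `TermLetters` ⟹
(`NodeOLetters.termWalkData_of_letters`) `TermWalkData 𝒦 (lettersPackage …)` ⟹ (`NodeOKernel216.Kernel216.of_termWalkData`) the (2.16)-level record
`Kernel216` ⟹ (`.localisation17a` ∕ `B13PrimitiveKernels216.differences216_of_two`) L17a ∧ L16a ⟹
(`b13Leaf_twoTorus_kernel216`) the b13 triple.  The tree's own junction `acrossSmall_of_walks(_std)` runs through the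
EXISTENTIAL binder `ExistsUniformAcrossSmall` (∃ package), behind which the localisation constants `K_G, K_Cs` and the
rate `κ` are hidden — whereas NODE A's numerics of (2.24)–(2.26) (`hθR1le`, `hsmallKθ`, `hαc`, `hsmall`, `hvol`) must
READ them.  This file therefore composes the per-term theorems (constants explicit: `κ = κ_C` of the rate book,
`K_G = 3B_Γ + B′_Γ ≤ K̄`, `K_Cs = 4∕m_A`, `θ_Γ, θ_E ≤ θ₀` by the exchange inequality) and states N10's leaf with the
W-walks rung as the ONE displayed kernel hypothesis and every numeric side condition in the rung's letters.
* §1 `kernel216_of_termWalks` — ONE term: `TermWalks 𝒦 q`, `q` admissible, a rate book with `0 < κ_C ≤ ρ′`,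
  `0 ≤ α < R` ⟹ `Kernel216 𝒦 α κ_C (3B_Γ + B′_Γ) (4∕m_A) θ_Γ θ_E` with `θ_• = 2K̄_•e^{−(ρ′−κ_C)R_σ} + 2K̄_•α∕R`;
  `kernel216_of_termWalks_le` — the same in ROUND LETTERS `(κ_C, K_G, K_Cs, θ₀, θ₀)` under `K̄ ≤ K_G`, `4∕m_A ≤ K_Cs` and
  the exchange inequality `2K̄(e^{−(ρ′−κ_C)R_σ} + α∕R) ≤ θ₀`; `exchange_of_thresholds` — print's two smallness sources
  (`α ≤ θ₀R∕(4K̄+4)`: the bigger analyticity space, p. 15; `R_σ ≥ log((4K̄+4)∕θ₀)∕(ρ′−κ_C)`: σ-cubes far from `Z₀`,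
  p. 13) give the exchange inequality (the arithmetic of `acrossSmall_of_walks_thresholds`, isolated);
  `termWalks_of_uniformWalksAcross` — a member's term of a family carrying `UniformWalksAcross 𝓣 q` carries
  `TermWalks` at any instances of its extra columns (subsingleton transport).
* §2 **`b13Leaf_twoTorus_walks`** — `b13Leaf_twoTorus_kernel216` with (i) the per-term kernel objects
  `(Λ, C₀, A(σ), G(σ), Γ₀, C, loc_Λ, loc_N)` of every term `t = (𝐃, P) ∈ terms L M₃ Z`, `Z ∈ 𝐃_{k+1}`, READ OFF a
  kernel family `𝒦 Z t : TermKernels c 4 N′ ν Nf E₃` at the configuration `u = uOf Z t φ`, `‖u‖ ≤ α` on `sp2 Z` (the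
  dictionary: `A(σ) := (𝒦 Z t).A2 σ u`, `G(σ) := (𝒦 Z t).G2 σ u`, `C := (𝒦 Z t).C ≻ 0`, `Γ₀ := (𝒦 Z t).Γ₀`), (ii) the
  records `h17`∕`h16` REPLACED by the displayed hypothesis `∀ Z, ∀ t ∈ terms L M₃ Z, TermWalks (𝒦 Z t) q` with
  `q.Admissible`, a rate book, the round letters and the exchange inequality, (iii) the rate chain
  `0 < κ″ < κ′ < κ < κ₂ < κ_C` and `θ_C` DERIVED as in `B13PrimitiveKernels216Reduced.h226_torus_of_two`; every other
  binder of the theorem of record (Lemma 1's data with the in-edges (1.24)∕(1.30), Lemma 2's data, NODE A's own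
  structural inputs `hAs`∕`hA`∕`hlin`∕separate holomorphy∕termwise domination, identifications, numbers) UNCHANGED and
  in the same order.  The node `Dag.B13_main (leavesP w P)` at a binding whose B13 group is the torus step then
  follows by `B13NodeTorusTermwise.b13_main_of_leaf_twoTorus` (not restated).
* §3 **`b13Leaf_twoTorus_uniformWalksAcross`** — THE FAN-OUT s3 SHAPE: for ANY family `𝓣 : S → TorusTerms c 4`
  carrying `UniformWalksAcross 𝓣 q` (`q` admissible with positive rates, `η ≤ etaMax`, the STANDARD rate book) whose
  member `s₀` lists the step's (2.14)-term kernels (`Wt : TwoTorusStep 4 L (𝓣 s₀).N′`, `idx Z t : (𝓣 s₀).ι`), print's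
  two thresholds and the binders of §2 ⟹ the b13 triple — N10's leaf CLOSED MODULO NODE A's ONE Prop for the family.
CHAIN (by name): `UniformWalksAcross 𝓣 q` ⟹ (§1) `Kernel216` per term ⟹ L17a ∧ L16a per term and configuration ⟹
`b13Leaf_twoTorus_kernel216` ⟹ `Lemma1Printed ∧ Lemma2Printed ∧ Lemma3Printed` ⟹
(`B13NodeTorusTermwise.b13_main_of_leaf_twoTorus`) `Dag.B13_main (leavesP w P)` at a pin.  Upstream producers of the hypothesis for PRESENTED families (cell
pub-balaban, row (D4)): `B13TermWalksPullback.uniformWalksAcross_of_pullbacks` ∕ `…_of_placements` (window-space data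
carrying `TermWalks` with one package ⟹ `UniformWalksAcross` for the pulled-back family) — cited, not used here.

CITATIONS.  [Balaban1988RG2Cluster] Lemma 1 p. 9, Lemma 2 p. 11, Lemma 3 (2.38) p. 20; p. 13 (*"generalized random
walk expansions discussed in [13] for all operators determining Δ_k, and for C^{(k)}(Z₀)"*), p. 15 (*"The general
case is handled by a perturbative argument"*, the bigger analyticity space), (2.14)–(2.16) pp. 15–16, (2.24)–(2.26)
p. 17; [Balaban1985BackgroundPropagators] Thm 3.10 ∕ (3.108) p. 416, (3.154) p. 427.

HONEST FRAMING: by-name composition of tree theorems; NOTHING of Bałaban's operators is constructed; that HIS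
`C*Δ_k(σ)C_{Z₀ᶜ}`, `C*Δ_k(σ,𝐔,𝐉)C`, `Δ^{(k)}(Z₀,σ)` carry ONE W-walks package across the exhausting family at complex
backgrounds (`UniformWalksAcross 𝓣_Bałaban q`, k-uniform — [13] Thm 3.10, cell GAPS G-B9-10, in-edge N06 ∕ FAN-OUT
§N06 s4) is the HYPOTHESIS of every theorem here, not an output; so are the in-edges (1.24)∕(1.30) ([I] (3.54),
(3.17); [15] Prop. 4), NODE A's structural inputs and the NODE-00 pin of the B13 group (`CarriersB13`, not in tree).
Count-neutral Track-A side landing; N10 NOT discharged; NOT NODE O for Bałaban's family; one finite four-torus; Bałaban AS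
PRINTED with page locators; nothing continuum ∕ ℝ⁴ ∕ OS ∕ mass-gap ∕ Clay.  0 `sorry`, 0 `def`, no instance, no
notation; standard axioms.
-/

noncomputable section

namespace Literature.MathematicalPhysics.QuantumFieldTheory.Balaban1983to89.B13NodeTorusWalks

open Metric Set
open Literature.MathematicalPhysics.QuantumFieldTheory.Balaban1983to89
open Literature.MathematicalPhysics.QuantumFieldTheory.Balaban1983to89.B16Absorption (pbox)
open Literature.MathematicalPhysics.QuantumFieldTheory.Balaban1983to89.TreeLengthTorus
open Literature.MathematicalPhysics.QuantumFieldTheory.Balaban1983to89.TreeLengthTorusGeometry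
open Literature.MathematicalPhysics.QuantumFieldTheory.Balaban1983to89.TreeLengthTorusTransfer
open Literature.MathematicalPhysics.QuantumFieldTheory.Balaban1983to89.B12TreeDecay (kappa₀ K₀)
open Literature.MathematicalPhysics.QuantumFieldTheory.Balaban1983to89.B13Lemma3TorusData
open Literature.MathematicalPhysics.QuantumFieldTheory.Balaban1983to89.B13Lemma3Torus (TwoTorusStep)
open Literature.MathematicalPhysics.QuantumFieldTheory.Balaban1983to89.B13Lemma3TorusSocket (Lemma3Numerics)
open Literature.MathematicalPhysics.QuantumFieldTheory.Balaban1983to89.B13PkScaling (Qop scaled)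
open Literature.MathematicalPhysics.QuantumFieldTheory.Balaban1983to89.DagBinding
open Literature.MathematicalPhysics.QuantumFieldTheory.Balaban1983to89.B13Bound143 (invTau R12)
open Literature.MathematicalPhysics.QuantumFieldTheory.Balaban1983to89.B13Term214 (term214 SepHolOn core214 F214)
open Literature.MathematicalPhysics.QuantumFieldTheory.Balaban1983to89.B13Lemma3TorusTerms (terms weight Z0)
open Literature.MathematicalPhysics.QuantumFieldTheory.Balaban1983to89.B5TorusCover (UT)
open Literature.MathematicalPhysics.QuantumFieldTheory.Balaban1983to89.B9Thm37GlueTorus (tdist1 tdist1_nonneg)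
open Literature.MathematicalPhysics.QuantumFieldTheory.Balaban1983to89.B13PrimitiveKernels216
  (Localisation17a Differences216 localisation17a_mono_rate differences216_of_two)
open Literature.MathematicalPhysics.QuantumFieldTheory.Balaban1983to89.B13NodeTorusKernel216 (b13Leaf_twoTorus_kernel216)
open Literature.MathematicalPhysics.QuantumFieldTheory.Balaban1983to89.B13TermWalkData (TermKernels TorusTerms)
open Literature.MathematicalPhysics.QuantumFieldTheory.Balaban1983to89.NodeOLetters (lettersPackage termWalkData_of_letters)
open Literature.MathematicalPhysics.QuantumFieldTheory.Balaban1983to89.NodeOKernel216 (Kernel216)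
open Literature.MathematicalPhysics.QuantumFieldTheory.Balaban1983to89.NodeOLettersOfWalksAcross
  (WalkPackage RateBook TermWalks UniformWalksAcross termLetters_of_termWalks)

/-! ## §1. One term: NODE O's (2.16)-level record from the W-walks datum, constants explicit -/

section OneTerm

variable {c : B13.Consts} {d N' ν : ℕ} {Nf : Fin ν → ℕ} [∀ i, NeZero (Nf i)]
variable {E : Type*} [NormedAddCommGroup E] [NormedSpace ℂ E]

/-- **THE (2.16)-LEVEL RECORD OF ONE TERM FROM ITS W-WALKS DATUM, CONSTANTS EXPLICIT.**  A (2.14)-term whose kernel data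
`𝒦` carry `TermWalks 𝒦 q` with an admissible package `q`, any rate book `r` of `q` with `0 < κ_C ≤ ρ′`, and a
configuration size `0 ≤ α < R`: the section satisfies `Kernel216` at rate `κ_C` with the localisation constants
`K_G = 3B_Γ + B′_Γ`, `K_Cs = 4∕m_A` and the difference constants `θ_Γ = 2(3B_Γ + B′_Γ)(e^{−(ρ′−κ_C)R_σ} + α∕R)`,
`θ_E = 2(5K̄_A)(e^{−(ρ′−κ_C)R_σ} + α∕R)` — kernel-checked composition `termLetters_of_termWalks` ⟶
`termWalkData_of_letters` (package `lettersPackage R ρ′ κ_C B_Γ B′_Γ K̄_A 2K̄_A (4∕m_A) R_σ`) ⟶ `Kernel216.of_termWalkData`.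
[cite: Balaban1988RG2Cluster, (2.7) p.13, p.15, (2.14)–(2.16) pp.15–16; Balaban1985BackgroundPropagators, Thm 3.10 p.416] -/
theorem kernel216_of_termWalks {𝒦 : TermKernels c d N' ν Nf E} [Fintype 𝒦.C₀] [DecidableEq 𝒦.C₀] {q : WalkPackage}
    (hq : q.Admissible) (r : RateBook q) (hw : TermWalks 𝒦 q) (hκC : 0 < r.κC) (hκCρ : r.κC ≤ r.ρ')
    {α : ℝ} (hα : 0 ≤ α) (hαR : α < q.R) :
    Kernel216 𝒦 α r.κC (3 * q.BΓ + q.BΓ') (4 / q.mA)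
      (2 * (3 * q.BΓ + q.BΓ') * Real.exp (-((r.ρ' - r.κC) * q.Rσ)) + 2 * (3 * q.BΓ + q.BΓ') * α / q.R)
      (2 * (3 * q.KbarA + 2 * q.KbarA) * Real.exp (-((r.ρ' - r.κC) * q.Rσ))
        + 2 * (3 * q.KbarA + 2 * q.KbarA) * α / q.R) := by
  have hL := termLetters_of_termWalks hq r hw
  have hD := termWalkData_of_letters hL hκC.le
  have hBΓ := WalkPackage.BΓ_nonneg hq
  have hBΓ' := WalkPackage.BΓ'_nonneg hq
  have hKA := hq.hKbarA
  have hmA := hq.hmA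
  have hadm : (lettersPackage q.R r.ρ' r.κC q.BΓ q.BΓ' q.KbarA (2 * q.KbarA) (4 / q.mA) q.Rσ).Admissible α q.Rσ :=
    ⟨hαR, sub_nonneg.2 hκCρ, hκC, show 0 ≤ 3 * q.BΓ + q.BΓ' by linarith,
      show 0 ≤ 3 * q.KbarA + 2 * q.KbarA by linarith, show 0 ≤ 4 / q.mA by positivity, le_rfl⟩
  exact Kernel216.of_termWalkData hadm hα hD

/-- **The same record in ROUND LETTERS** `(κ_C, K_G, K_Cs, θ₀, θ₀)`: if `K̄ ≤ K_G` (`K̄ = q.Kbar = max(3B_Γ + B′_Γ, 5K̄_A)`),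
`4∕m_A ≤ K_Cs` and the exchange inequality `2K̄(e^{−(ρ′−κ_C)R_σ} + α∕R) ≤ θ₀` holds, then `Kernel216 𝒦 α κ_C K_G K_Cs θ₀ θ₀`
(`Kernel216.weaken`).  These are the letters NODE A's numerics read. [cite: Balaban1988RG2Cluster, (1.11) p.5, p.15, (2.16) p.16] -/
theorem kernel216_of_termWalks_le {𝒦 : TermKernels c d N' ν Nf E} [Fintype 𝒦.C₀] [DecidableEq 𝒦.C₀] {q : WalkPackage}
    (hq : q.Admissible) (r : RateBook q) (hw : TermWalks 𝒦 q) (hκC : 0 < r.κC) (hκCρ : r.κC ≤ r.ρ')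
    {α : ℝ} (hα : 0 ≤ α) (hαR : α < q.R) {KG KCs θ₀ : ℝ} (hKG : q.Kbar ≤ KG) (hKCs : 4 / q.mA ≤ KCs)
    (hθ : 2 * q.Kbar * (Real.exp (-((r.ρ' - r.κC) * q.Rσ)) + α / q.R) ≤ θ₀) :
    Kernel216 𝒦 α r.κC KG KCs θ₀ θ₀ := by
  have hBΓ := WalkPackage.BΓ_nonneg hq
  have hBΓ' := WalkPackage.BΓ'_nonneg hq
  have hKA := hq.hKbarA
  have hmA := hq.hmA
  have hR := hq.hR
  have hsum : 0 ≤ Real.exp (-((r.ρ' - r.κC) * q.Rσ)) + α / q.R :=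
    add_nonneg (Real.exp_pos _).le (div_nonneg hα hR.le)
  have h1 : 3 * q.BΓ + q.BΓ' ≤ q.Kbar := le_max_left _ _
  have h2 : 3 * q.KbarA + 2 * q.KbarA ≤ q.Kbar := le_max_right _ _
  have hΓ : 2 * (3 * q.BΓ + q.BΓ') * Real.exp (-((r.ρ' - r.κC) * q.Rσ)) + 2 * (3 * q.BΓ + q.BΓ') * α / q.R ≤ θ₀ :=
    calc 2 * (3 * q.BΓ + q.BΓ') * Real.exp (-((r.ρ' - r.κC) * q.Rσ)) + 2 * (3 * q.BΓ + q.BΓ') * α / q.R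
          = 2 * (3 * q.BΓ + q.BΓ') * (Real.exp (-((r.ρ' - r.κC) * q.Rσ)) + α / q.R) := by ring
      _ ≤ 2 * q.Kbar * (Real.exp (-((r.ρ' - r.κC) * q.Rσ)) + α / q.R) :=
          mul_le_mul_of_nonneg_right (by linarith) hsum
      _ ≤ θ₀ := hθ
  have hE : 2 * (3 * q.KbarA + 2 * q.KbarA) * Real.exp (-((r.ρ' - r.κC) * q.Rσ))
        + 2 * (3 * q.KbarA + 2 * q.KbarA) * α / q.R ≤ θ₀ :=
    calc 2 * (3 * q.KbarA + 2 * q.KbarA) * Real.exp (-((r.ρ' - r.κC) * q.Rσ))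
            + 2 * (3 * q.KbarA + 2 * q.KbarA) * α / q.R
          = 2 * (3 * q.KbarA + 2 * q.KbarA) * (Real.exp (-((r.ρ' - r.κC) * q.Rσ)) + α / q.R) := by ring
      _ ≤ 2 * q.Kbar * (Real.exp (-((r.ρ' - r.κC) * q.Rσ)) + α / q.R) :=
          mul_le_mul_of_nonneg_right (by linarith) hsum
      _ ≤ θ₀ := hθ
  have hΓ0 : 0 ≤ 2 * (3 * q.BΓ + q.BΓ') * Real.exp (-((r.ρ' - r.κC) * q.Rσ)) + 2 * (3 * q.BΓ + q.BΓ') * α / q.R := by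
    rw [show 2 * (3 * q.BΓ + q.BΓ') * Real.exp (-((r.ρ' - r.κC) * q.Rσ)) + 2 * (3 * q.BΓ + q.BΓ') * α / q.R
        = 2 * (3 * q.BΓ + q.BΓ') * (Real.exp (-((r.ρ' - r.κC) * q.Rσ)) + α / q.R) by ring]
    exact mul_nonneg (by linarith) hsum
  have hE0 : 0 ≤ 2 * (3 * q.KbarA + 2 * q.KbarA) * Real.exp (-((r.ρ' - r.κC) * q.Rσ))
      + 2 * (3 * q.KbarA + 2 * q.KbarA) * α / q.R := by
    rw [show 2 * (3 * q.KbarA + 2 * q.KbarA) * Real.exp (-((r.ρ' - r.κC) * q.Rσ))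
          + 2 * (3 * q.KbarA + 2 * q.KbarA) * α / q.R
        = 2 * (3 * q.KbarA + 2 * q.KbarA) * (Real.exp (-((r.ρ' - r.κC) * q.Rσ)) + α / q.R) by ring]
    exact mul_nonneg (by linarith) hsum
  exact (kernel216_of_termWalks hq r hw hκC hκCρ hα hαR).weaken (by linarith) (by positivity) hΓ0 hE0
    le_rfl (h1.trans hKG) hKCs hΓ hE

/-- **PRINT's TWO SMALLNESS SOURCES GIVE THE EXCHANGE INEQUALITY** (the arithmetic of
`NodeOLettersOfWalksAcross.acrossSmall_of_walks_thresholds`, isolated for re-use with explicit letters): for a rate book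
with `κ_C < ρ′` and `θ₀ > 0`, if `α ≤ θ₀R∕(4K̄ + 4)` (the bigger analyticity space, p. 15: `O(α₀ + α₁)`) and
`R_σ ≥ log((4K̄ + 4)∕θ₀)∕(ρ′ − κ_C)` (σ-cubes far from `Z₀`, p. 13: `O(1)e^{−⅓δ₀M}`, `M` large) then
`2K̄(e^{−(ρ′−κ_C)R_σ} + α∕R) ≤ θ₀`. [cite: Balaban1988RG2Cluster, (1.11) p.5, p.13, p.15] -/
theorem exchange_of_thresholds {q : WalkPackage} (hq : q.Admissible) (r : RateBook q) (hκCρ : r.κC < r.ρ')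
    {α θ₀ : ℝ} (hθ₀ : 0 < θ₀) (hαsmall : α ≤ θ₀ * q.R / (4 * q.Kbar + 4))
    (hRσlarge : Real.log ((4 * q.Kbar + 4) / θ₀) / (r.ρ' - r.κC) ≤ q.Rσ) :
    2 * q.Kbar * (Real.exp (-((r.ρ' - r.κC) * q.Rσ)) + α / q.R) ≤ θ₀ := by
  have hK : 0 ≤ q.Kbar := WalkPackage.Kbar_nonneg hq
  have hR := hq.hR
  have h4 : 0 < 4 * q.Kbar + 4 := by positivity
  have hε : 0 < r.ρ' - r.κC := sub_pos.2 hκCρ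
  -- the far-ness threshold ⟹ `e^{−εR_σ} ≤ θ₀/(4K̄+4)`
  have h1 : Real.log ((4 * q.Kbar + 4) / θ₀) ≤ (r.ρ' - r.κC) * q.Rσ := (div_le_iff₀' hε).1 hRσlarge
  have h2 : (4 * q.Kbar + 4) / θ₀ ≤ Real.exp ((r.ρ' - r.κC) * q.Rσ) :=
    (Real.log_le_iff_le_exp (by positivity)).1 h1
  have h3 : Real.exp (-((r.ρ' - r.κC) * q.Rσ)) ≤ θ₀ / (4 * q.Kbar + 4) := by
    rw [Real.exp_neg, inv_le_comm₀ (Real.exp_pos _) (by positivity), inv_div]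
    exact h2
  -- the analyticity-space threshold ⟹ `α/R ≤ θ₀/(4K̄+4)`
  have h5 : α / q.R ≤ θ₀ / (4 * q.Kbar + 4) := by
    rw [div_le_iff₀ hR]
    calc α ≤ θ₀ * q.R / (4 * q.Kbar + 4) := hαsmall
      _ = θ₀ / (4 * q.Kbar + 4) * q.R := by ring
  have h6 : 2 * q.Kbar * (Real.exp (-((r.ρ' - r.κC) * q.Rσ)) + α / q.R) ≤
      2 * q.Kbar * (θ₀ / (4 * q.Kbar + 4) + θ₀ / (4 * q.Kbar + 4)) :=
    mul_le_mul_of_nonneg_left (add_le_add h3 h5) (by positivity)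
  have h7 : 2 * q.Kbar * (θ₀ / (4 * q.Kbar + 4) + θ₀ / (4 * q.Kbar + 4)) = (4 * q.Kbar) * θ₀ / (4 * q.Kbar + 4) := by
    ring
  have h8 : (4 * q.Kbar) * θ₀ / (4 * q.Kbar + 4) ≤ θ₀ := by
    rw [div_le_iff₀ h4]; nlinarith
  linarith

/-- **A member's term of a family carrying the rung carries `TermWalks` — at ANY instances of its extra columns**
(`UniformWalksAcross` packages the `Fintype`∕`DecidableEq` structures of `C₀` as `∃`-binders; both are subsingletons,
so the datum transports to the instances a consumer's statement fixes). [cite: Balaban1988RG2Cluster, p.13, p.15] -/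
theorem termWalks_of_uniformWalksAcross {S : Type*} {𝓣 : S → TorusTerms c d} {q : WalkPackage}
    (hall : UniformWalksAcross 𝓣 q) (s : S) (i : (𝓣 s).ι)
    [hF : Fintype ((𝓣 s).𝒦 i).C₀] [hD : DecidableEq ((𝓣 s).𝒦 i).C₀] : TermWalks ((𝓣 s).𝒦 i) q := by
  obtain ⟨hF', hD', hw⟩ := hall s i
  have h1 : hF' = hF := Subsingleton.elim _ _
  have h2 : hD' = hD := Subsingleton.elim _ _
  subst h1 h2
  exact hw

end OneTerm

/-! ## §2. The B13 leaf triple on the two-scale torus with L17a ∕ L16a READ OFF the W-walks rung -/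

section Walks

variable {L N' : ℕ} [NeZero L] [NeZero N']

open Matrix

open Classical in
/-- **THE B13 LEAF TRIPLE ON THE TWO-SCALE TORUS WITH LEMMA 3's KERNEL INPUTS DISCHARGED FROM THE W-WALKS RUNG**
([Balaban1988RG2Cluster] Lemma 1 p. 9, Lemma 2 p. 11, Lemma 3 (2.38) p. 20 via (2.14)–(2.26) pp. 15–17; the walk
expansions of p. 13 ∕ [Balaban1985BackgroundPropagators] Thm 3.10).  Exactly
`B13NodeTorusKernel216.b13Leaf_twoTorus_kernel216` (p417989) — Lemma 1's index data of (1.33), per-term analyticity, per-term (1.24)∕(1.30) (the IN-EDGES, by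
reference to [I] (3.54), (3.17), [15] Prop. 4), thresholds, R8∕R9, the constants with headroom; Lemma 2's V″_k = V′_k +
local pieces, per-cube scaled cubic terms, identifications, floor, gauge invariance by assertion; Lemma 3's numerics
bundle, Cauchy radius and parameter domains, per-term parameter lists, (2.3) characteristic functions, sub-families and
potentials through the embedding of the real field, termwise domination, separate holomorphy, NODE A's structural
inputs (`hAs`, `hA`: the term precision symmetric with `Re ≻ 0` on the polydisc at the configuration; `hlin`), `Γ₀`'s
form bound, the (2.24)–(2.25) smallness and the p. 17 constant matching — EXCEPT THAT
(i) the per-term kernel objects are READ OFF a kernel family `𝒦 Z t : TermKernels c 4 N′ ν Nf E₃` (row bonds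
`Λ := (𝒦 Z t).Λ`, extra columns `C₀ := (𝒦 Z t).C₀`, bond locations `loc_Λ, loc_N`, reference covariance
`C := (𝒦 Z t).C ≻ 0` with eigenvalue bound `hcE`, `Γ₀ := (𝒦 Z t).Γ₀`) AT THE CONFIGURATION `u = uOf Z t φ ∈ E₃` of
`φ ∈ sp2 Z`, `‖u‖ ≤ α` (`huα`; the dictionary (𝐔,𝐉) = (U,0) + u of p. 15): `A(σ) := (𝒦 Z t).A2 σ u`,
`G(σ) := (𝒦 Z t).G2 σ u`;
(ii) the two NAMED (2.16)-level records `h17 : Localisation17a …`, `h16 : Differences216 …` per term and configuration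
are NO LONGER HYPOTHESES: in their place THE W-WALKS RUNG ON THE TERMS OF THE STEP — `hwalks : ∀ Z, ∀ t ∈ terms L M₃ Z,
TermWalks (𝒦 Z t) q` for ONE sixteen-constant package `q` (`q.Admissible`), a rate book `rb` with `0 < κ_C ≤ ρ′`,
`α < R`, round letters `K̄ ≤ K_G`, `4∕m_A ≤ K_Cs` and the exchange inequality `2K̄(e^{−(ρ′−κ_C)R_σ} + α∕R) ≤ θ₀`
(from print's two thresholds by `exchange_of_thresholds`);
(iii) the rates are `0 < κ″ < κ′ < κ < κ₂ < κ_C` and in NODE A's letter `ϑ` the constants are `K_Γ = K_G`,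
`K₀′ = K_Cs`, `θ_Γ = θ_E = θ₀`, `θ_C = K_Cs·θ₀·(m(1+2∕(κ_C−κ₂))^ν)·K_Cs·(m(1+2∕(κ₂−κ))^ν)` DERIVED
(`B13PrimitiveKernels216.differences216_of_two`).
Proof: per term and configuration `kernel216_of_termWalks_le` ⟶ `Kernel216.localisation17a` (lowered to rate `κ` by
`localisation17a_mono_rate`) and `differences216_of_two`, fed to the theorem of record.  CONCLUSION UNCHANGED:
`Lemma1Printed ∧ Lemma2Printed ∧ Lemma3Printed` for `Wt.toStepData`; the node at a pin by `B13NodeTorusTermwise.b13_main_of_leaf_twoTorus`.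
What remains by assertion: the rung for BAŁABAN's kernels (NODE A's object content = in-edge N06, k-uniform), the
in-edges (1.24)∕(1.30), NODE A's structural inputs, identifications of a NODE-00 pin, numbers.
[cite: Balaban1988RG2Cluster, Lemmas 1–3 pp.9, 11, 20; p.13, p.15, (2.14)–(2.26) pp.15–17; Balaban1985BackgroundPropagators, Thm 3.10 p.416] -/
theorem b13Leaf_twoTorus_walks
    (Wt : TwoTorusStep 4 L N') (c : B13.Consts) (k : ℕ) (hN12 : 12 ≤ L * N') (hL8 : 8 ≤ c.L) (hLc : c.L = L)
    -- (1) LEMMA 1: index data of (1.33)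
    (S0 : TDom 4 (L * N') → Finset (TPt 4 (L * N')))
    (F : TDom 4 (L * N') → TPt 4 (L * N') → Finset (TPt 4 (L * N')))
    (Sq : TDom 4 (L * N') → TPt 4 (L * N') → (j : ℕ) → Finset (TPt 4 (L ^ (k - j) * (L * N'))))
    (SX : TDom 4 (L * N') → TPt 4 (L * N') → (j : ℕ) → TPt 4 (L ^ (k - j) * (L * N')) →
      Finset (TDom 4 (L ^ (k - j) * (L * N'))))
    (T : TDom 4 (L * N') → TPt 4 (L * N') → Finset (TPt 4 (L * N')) → (j : ℕ) →
      TPt 4 (L ^ (k - j) * (L * N')) → TDom 4 (L ^ (k - j) * (L * N')) → Wt.Φ → ℂ)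
    (Sc : TDom 4 (L * N') → Finset (TPt 4 (L * N')))
    (Sq' : TDom 4 (L * N') → TPt 4 (L * N') → (j : ℕ) → Finset (TPt 4 (L ^ (k - j) * (L * N'))))
    (SX' : TDom 4 (L * N') → TPt 4 (L * N') → (j : ℕ) → TPt 4 (L ^ (k - j) * (L * N')) →
      Finset (TDom 4 (L ^ (k - j) * (L * N'))))
    (T' : TDom 4 (L * N') → TPt 4 (L * N') → (j : ℕ) → TPt 4 (L ^ (k - j) * (L * N')) →
      TDom 4 (L ^ (k - j) * (L * N')) → Wt.Φ → ℂ)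
    (dist : TDom 4 (L * N') → TPt 4 (L * N') → (j : ℕ) → TPt 4 (L ^ (k - j) * (L * N')) → ℝ) {K K' : ℝ}
    (h133 : ∀ Y, Wt.Vp Y =
      (∑ a ∈ S0 Y, ∑ X ∈ (F Y a).powerset, ∑ j ∈ Finset.range (k + 1), ∑ q ∈ Sq Y a j,
        ∑ x ∈ SX Y a j q, T Y a X j q x) +
      (∑ a ∈ Sc Y, ∑ j ∈ Finset.range (k + 1), ∑ q ∈ Sq' Y a j, ∑ x ∈ SX' Y a j q, T' Y a j q x))
    (hS0Y : ∀ Y, ∀ a ∈ S0 Y,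
      (pbox (fun i => natLift a i - (5 : ℕ)) (fun i => natLift a i + 1 + (5 : ℕ))).image (proj (L * N')) ⊆ Y.1)
    (hFsub : ∀ Y a, F Y a ⊆
      (pbox (fun i => natLift a i - (5 : ℕ)) (fun i => natLift a i + 1 + (5 : ℕ))).image (proj (L * N')) \
        (pbox (fun i => natLift a i - (4 : ℕ)) (fun i => natLift a i + 1 + (4 : ℕ))).image (proj (L * N')))
    (hSq : ∀ Y, ∀ a ∈ S0 Y, ∀ j, Sq Y a j ⊆ (Finset.univ : Finset (TPt 4 (L ^ (k - j) * (L * N')))).filter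
      (fun q => tcoarse (L ^ (k - j)) (L * N') q ∈
        (pbox (fun i => natLift a i - (2 : ℕ)) (fun i => natLift a i + 1 + (2 : ℕ))).image (proj (L * N'))))
    (hScY : ∀ Y, Sc Y ⊆ Y.1)
    (hdist0 : ∀ Y a j q, 0 ≤ c.δ₀ * dist Y a j q)
    (hdist : ∀ Y a j (n : ℕ) q, q ∉ (pbox (fun i => ((L ^ (k - j) : ℕ) : ℤ) * natLift a i - (n + 1 : ℕ))
      (fun i => ((L ^ (k - j) : ℕ) : ℤ) * natLift a i + 2 * ((L ^ (k - j) : ℕ) : ℤ) - 1 + (n + 1 : ℕ))).image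
        (proj (L ^ (k - j) * (L * N'))) → c.δ₀ * c.M * ((n : ℝ) + 1) ≤ c.δ₀ * dist Y a j q)
    (hSX : ∀ Y a j q, SX Y a j q ⊆ (tcubeSys 4 (L ^ (k - j) * (L * N'))).above q)
    (hSX' : ∀ Y a j q, SX' Y a j q ⊆ (tcubeSys 4 (L ^ (k - j) * (L * N'))).above q)
    (hX0 : ∀ Y, ∀ a ∈ Sc Y, ∀ j ∈ Finset.range (k + 1), ∀ q ∈ Sq' Y a j, ∀ x ∈ SX' Y a j q,
      x.1.image (tcoarse (L ^ (k - j)) (L * N')) ⊆ Y.1)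
    -- (1) LEMMA 1: analyticity of the terms, closure of `Analytic`
    (hAdd : ∀ (s : Set Wt.Φ) (f g : Wt.Φ → ℂ), Wt.Analytic f s → Wt.Analytic g s → Wt.Analytic (f + g) s)
    (hZero : ∀ s : Set Wt.Φ, Wt.Analytic 0 s)
    (hAnT : ∀ Y, ∀ a ∈ S0 Y, ∀ X ∈ (F Y a).powerset, ∀ j ∈ Finset.range (k + 1), ∀ q ∈ Sq Y a j,
      ∀ x ∈ SX Y a j q, Wt.Analytic (T Y a X j q x) (Wt.sp1 Y))
    (hAnT' : ∀ Y, ∀ a ∈ Sc Y, ∀ j ∈ Finset.range (k + 1), ∀ q ∈ Sq' Y a j, ∀ x ∈ SX' Y a j q,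
      Wt.Analytic (T' Y a j q x) (Wt.sp1 Y))
    -- (1) LEMMA 1: thresholds and restrictions
    (hK : 0 ≤ K) (hK' : 0 ≤ K') (hκ : 0 ≤ c.κ) (hδ1 : c.δ < 1) (hδκ : 1 ≤ c.δ * c.κ)
    (hκ126 : kappa₀ 64 8 ≤ c.κ) (hκ126' : kappa₀ 64 8 ≤ c.δ * c.κ)
    (hκ₁ : 1 + 2 * Real.log (8 * 12 ^ 3) ≤ c.κ₁) (hκ₁' : 2 + 16 * Real.log 128 ≤ c.κ₁)
    (hδ₀M : 10 * Real.exp (-1) ≤ c.δ₀ * c.M) (hδ₀M5 : 2 * Real.log 5 ≤ c.δ₀ * c.M)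
    (hR8 : (1 - c.δ) * c.κ ≤ (1 / 4) * (c.κ₁ - 1)) (hR9 : (1 - 2 * c.δ) * c.κ ≤ (1 / 16) * c.κ₁)
    -- (1) LEMMA 1: per-term (1.24), (1.30) (IN-EDGES); the constants of (1.36) with headroom (1 − θ) for the local pieces
    (h124 : ∀ Y φ, φ ∈ Wt.sp1 Y → ∀ a ∈ S0 Y, ∀ X ∈ (F Y a).powerset, ∀ j ∈ Finset.range (k + 1), ∀ q ∈ Sq Y a j,
      ∀ x ∈ SX Y a j q,
        ‖T Y a X j q x φ‖ ≤ K * ((L : ℝ) ^ j * ((L : ℝ) ^ k)⁻¹) ^ 5 *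
          Real.exp (-(c.κ₁ - 1) *
            (((Y.1 \ (pbox (fun i => natLift a i - (5 : ℕ)) (fun i => natLift a i + 1 + (5 : ℕ))).image
              (proj (L * N'))).card : ℝ) + X.card)) *
          Real.exp (-(c.κ * torusTreeLen x.1)))
    (h130 : ∀ Y φ, φ ∈ Wt.sp1 Y → ∀ a ∈ Sc Y, ∀ j ∈ Finset.range (k + 1), ∀ q ∈ Sq' Y a j,
      ∀ x ∈ SX' Y a j q,
        ‖T' Y a j q x φ‖ ≤ K' * Real.exp (-(1 / 2) * (c.δ₀ * c.M) * ((L : ℝ) ^ j * ((L : ℝ) ^ k)⁻¹)⁻¹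
            - (1 / 2) * c.δ₀ * dist Y a j q) *
          Real.exp (-(c.κ₁ - 1) * ((Y.1 \ x.1.image (tcoarse (L ^ (k - j)) (L * N'))).card : ℝ)) *
          Real.exp (-(c.κ * torusTreeLen x.1)))
    {θ : ℝ} (hθ0 : 0 ≤ θ) (hθ1 : θ < 1)
    (hC : K * K₀ 64 8 * (2 * (6 * (L : ℝ)) ^ 4) * Real.exp 1 * Real.exp ((1 / 8) * c.κ₁ * (12 ^ 4 - 1)) +
        2 * (64 * K') * K₀ 64 8 * 1344 ≤
      (1 - θ) * (c.E₀ * c.ε₁ * c.C₁ * c.M ^ c.q * Real.exp (c.C₂ * c.κ₁)))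
    -- (2) LEMMA 2 (pp. 10–11): V″_k = V′_k + the local pieces G of P^{(k)}, analytic and (1.36)-small at prefactor θ
    (Gl : TDom 4 (L * N') → Wt.Φ → ℂ) (hVpp : ∀ Y, Wt.Vpp Y = fun φ => Wt.Vp Y φ + Gl Y φ)
    (hGlAn : ∀ Y, Wt.Analytic (Gl Y) (Wt.sp1 Y))
    (hGl : ∀ Y φ, φ ∈ Wt.sp1 Y → ‖Gl Y φ‖ ≤ θ * (c.E₀ * c.ε₁ * c.C₁ * c.M ^ c.q * Real.exp (c.C₂ * c.κ₁)) *
      Real.exp (-((1 - 2 * c.δ) * c.κ * (tsys 4 (L * N')).dj Y)))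
    -- (2) LEMMA 2: the located per-term data of `B13Lemma2Torus.lemma2Printed_twoTorus'`
    {E : Type*} [NormedAddCommGroup E] [NormedSpace ℂ E]
    (rd : TDom 4 (L * N') → Wt.Φ → E) (e : TDom 4 (L * N') → Wt.Bond → E) (he : ∀ Y b, ‖e Y b‖ ≤ 1)
    (hrd : ∀ Y φ, rd Y φ = haveI := Wt.finBond; ∑ b, Wt.Bv φ b • e Y b)
    {ι₂ : Type*} (s : TDom 4 (L * N') → Finset ι₂) (Wf : TDom 4 (L * N') → ι₂ → Wt.Φ → E → ℂ) {g : ℂ} (hg : g ≠ 0)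
    {R K₂ : ℝ} {m₂ : ℕ} (hK₂ : 0 ≤ K₂) (hR : 0 < R) (h3 : 3 * c.ε₁ ≤ R)
    (hW : ∀ Y, ∀ i ∈ s Y, ∀ φ ∈ Wt.sp1 Y, AnalyticOnNhd ℂ (Wf Y i φ) (ball 0 R))
    (hKW : ∀ Y, ∀ i ∈ s Y, ∀ φ ∈ Wt.sp1 Y, ∀ z ∈ ball (0 : E) R,
      ‖Wf Y i φ z‖ ≤ K₂ * Real.exp (-(c.κ₁ - 1) * ((Y.1.card : ℝ) - 1)) * ‖z‖ ^ 3)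
    (hcard : ∀ Y, (s Y).card ≤ m₂ * Y.1.card)
    (hV : ∀ Y, Wt.V Y = fun φ => (∑ i ∈ s Y, scaled g (Wf Y i φ) (rd Y φ)) + Wt.Vpp Y φ)
    (hQ : ∀ Y φ (b b' : Wt.Bond), φ ∈ Wt.sp1 Y →
      Wt.Q Y φ b b' = 2 * ∑ i ∈ s Y, Qop (scaled g (Wf Y i φ)) (rd Y φ) (e Y b) (e Y b'))
    (hsp : ∀ Y φ, φ ∈ Wt.sp1 Y → ‖g‖ * ‖rd Y φ‖ < c.ε₁)
    (hvolk : ∀ Y, Wt.volk Y = Y.1.card)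
    (hfloor : 27 * m₂ * K₂ * Real.exp (c.κ₁ - 1) ≤ c.C₃ * c.M ^ 4 * Real.exp (c.C₂ * c.κ₁))
    (hAnP : ∀ Y, ∀ i ∈ s Y, Wt.Analytic (fun φ => scaled g (Wf Y i φ) (rd Y φ)) (Wt.sp1 Y))
    (hG : ∀ Y, Wt.GaugeInv (Wt.V Y) ∧ Wt.GaugeInv (Wt.toStepData.quadForm Y) ∧ Wt.GaugeInv (Wt.Vpp Y))
    -- (3) LEMMA 3 (pp. 14–20): the signs of (2.18)–(2.20), R12, |τ(Y)| ≥ 2, and the numerics bundle at ℓ = ½L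
    (M₃ : ℕ) [NeZero M₃] {a a₂ a₂' a₅ Aabs : ℝ} (hN : Lemma3Numerics c M₃ ((c.L : ℝ) / 2) a a₂ a₂' a₅ Aabs)
    (h12 : R12 c) (hE : 0 < c.E₀) (hε : 0 < c.ε₁) (hC₁ : 0 < c.C₁) (hα : 0 < c.α₄) (hM : 1 ≤ c.M)
    (hτ2 : c.E₀ * c.ε₁ * c.C₁ * c.α₄⁻¹ * c.M ^ c.q * Real.exp (c.C₂ * c.κ₁) ≤ 1 / 2)
    -- (3) the Cauchy radius and the parameter domains (p. 15)
    {Uσ Uτ : Set ℂ} (hUσ : IsOpen Uσ) (hUτ : IsOpen Uτ) (hUexp : Metric.closedBall (0 : ℂ) (Real.exp c.κ₁) ⊆ Uσ)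
    (hUtau : ∀ Y : TDom 4 (L * N'), Metric.closedBall (0 : ℂ) ((invTau c ((tsys 4 (L * N')).dj Y))⁻¹) ⊆ Uτ)
    {r : ℝ} (hr : 0 < r) (hr' : r ≤ Real.exp c.κ₁ - 1)
    (hsubτ : ∀ x ∈ Set.uIcc (0 : ℝ) 1, Metric.closedBall (x : ℂ) r ⊆ Uτ)
    -- (3) THE DICTIONARY: per term (𝐃, P) of every Z ∈ 𝐃_{k+1}, the kernel data `𝒦 Z t` on a site torus `UT Nf` with
    --     configuration space `E₃`, and the configuration `u = uOf Z t φ` of `φ ∈ sp2 Z`, of size ≤ α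
    {ν : ℕ} {Nf : Fin ν → ℕ} [∀ i, NeZero (Nf i)]
    {E₃ : Type*} [NormedAddCommGroup E₃] [NormedSpace ℂ E₃]
    (𝒦 : TDom 4 N' → Finset (TDom 4 (L * N')) × Finset (TBond 4 M₃ (L * N')) → TermKernels c 4 N' ν Nf E₃)
    [∀ Z t, Fintype (𝒦 Z t).C₀] [∀ Z t, DecidableEq (𝒦 Z t).C₀]
    (uOf : (Z : TDom 4 N') → (t : Finset (TDom 4 (L * N')) × Finset (TBond 4 M₃ (L * N'))) → Wt.Φ → E₃)
    {α : ℝ} (hαnn : 0 ≤ α) (huα : ∀ Z, ∀ t ∈ terms L M₃ Z, ∀ φ ∈ Wt.sp2 Z, ‖uOf Z t φ‖ ≤ α)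
    -- (3) per term: parameter lists, the linear map Γ(σ), characteristic functions, potentials
    (lZ : TDom 4 N' → Finset (TDom 4 (L * N')) × Finset (TBond 4 M₃ (L * N')) → List (TPt 4 N'))
    (hlZ : ∀ Z, ∀ t ∈ terms L M₃ Z, (lZ Z t).Nodup ∧ (lZ Z t).toFinset = Z.1 \ tclosure L N' (Z0 M₃ t))
    (lD : TDom 4 N' → Finset (TDom 4 (L * N')) × Finset (TBond 4 M₃ (L * N')) → List (TDom 4 (L * N')))
    (hlD : ∀ Z, ∀ t ∈ terms L M₃ Z, (lD Z t).Nodup ∧ (lD Z t).toFinset = t.1)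
    (Γm : (Z : TDom 4 N') → (t : Finset (TDom 4 (L * N')) × Finset (TBond 4 M₃ (L * N'))) → Wt.Φ →
      (TPt 4 N' → ℂ) → ((𝒦 Z t).Λ ⊕ (𝒦 Z t).C₀ → ℝ) → ((𝒦 Z t).Λ → ℂ))
    (χY₀ χcP : (Z : TDom 4 N') → (t : Finset (TDom 4 (L * N')) × Finset (TBond 4 M₃ (L * N'))) →
      ((𝒦 Z t).Λ → ℝ) → ℝ)
    (hχ0 : ∀ Z t B, 0 ≤ χY₀ Z t B) (hχ1 : ∀ Z t B, χY₀ Z t B ≤ 1)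
    (Pl : (Z : TDom 4 N') → (t : Finset (TDom 4 (L * N')) × Finset (TBond 4 M₃ (L * N'))) → Finset (𝒦 Z t).Λ)
    (hPcard : ∀ Z, ∀ t ∈ terms L M₃ Z, (Pl Z t).card = t.2.card) {rP : ℝ} (hrP : 0 ≤ rP)
    (hχc : ∀ Z t B, χcP Z t B = ∏ b ∈ Pl Z t, (if rP ≤ |B b| then (1 : ℝ) else 0))
    (Dfam : TDom 4 N' → Finset (TDom 4 (L * N')) × Finset (TBond 4 M₃ (L * N')) → Finset (TDom 4 (L * N')))
    (Vr : (Z : TDom 4 N') → (t : Finset (TDom 4 (L * N')) × Finset (TBond 4 M₃ (L * N'))) → Wt.Φ →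
      TDom 4 (L * N') → ((𝒦 Z t).Λ → ℝ) → ℂ)
    -- (3) termwise domination: ‖H(Z)‖ ≤ Σ_{(𝐃,P)} ‖(2.14)‖ on the space of p. 15 ((2.9)/(2.14))
    (hH : ∀ (Z : TDom 4 N') (φ : Wt.Φ), φ ∈ Wt.sp2 Z → ‖Wt.H Z φ‖ ≤
      ∑ t ∈ terms L M₃ Z, ‖term214 r (lZ Z t) (lD Z t)
        (core214 (fun σ => (𝒦 Z t).A2 σ (uOf Z t φ)) (Γm Z t φ)
          (F214 t.2.card (χY₀ Z t) (χcP Z t) (Dfam Z t) (Vr Z t φ))) 0 0‖)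
    -- (3) the record's objects behind the terms: bonds, cubes, the real field inside the configurations
    (ιb : (Z : TDom 4 N') → (t : Finset (TDom 4 (L * N')) × Finset (TBond 4 M₃ (L * N'))) → (𝒦 Z t).Λ → Wt.Bond)
    (hι : ∀ Z t, Function.Injective (ιb Z t)) (cube : Wt.Bond → TPt 4 (L * N'))
    (hQsupp : ∀ (Y : TDom 4 (L * N')) φ b b', Wt.Q Y φ b b' ≠ 0 → cube b ∈ Y.1 ∧ cube b' ∈ Y.1)
    {m' : ℕ} (hfibc : ∀ Z t (x : TPt 4 (L * N')), (Finset.univ.filter fun j => cube (ιb Z t j) = x).card ≤ m')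
    (emb : (Z : TDom 4 N') → (t : Finset (TDom 4 (L * N')) × Finset (TBond 4 M₃ (L * N'))) → Wt.Φ →
      ((𝒦 Z t).Λ → ℝ) → Wt.Φ)
    (hBv : ∀ Z t φ B b, Wt.Bv (emb Z t φ B) (ιb Z t b) = (B b : ℂ))
    (hBv0 : ∀ Z t φ B b', b' ∉ Set.range (ιb Z t) → Wt.Bv (emb Z t φ B) b' = 0)
    (hVr : ∀ Z, ∀ t ∈ terms L M₃ Z, ∀ φ ∈ Wt.sp2 Z, ∀ Y ∈ Dfam Z t, ∀ B,
      emb Z t φ B ∈ Wt.sp1 Y → Vr Z t φ Y B = Wt.V Y (emb Z t φ B))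
    (hχsupp : ∀ Z, ∀ t ∈ terms L M₃ Z, ∀ φ ∈ Wt.sp2 Z, ∀ B, χY₀ Z t B ≠ 0 → ∀ Y ∈ Dfam Z t,
      emb Z t φ B ∈ Wt.sp1 Y)
    -- (3) separate holomorphy of the X-integral in (σ, τ)
    (hΨσ : ∀ Z, ∀ t ∈ terms L M₃ Z, ∀ φ ∈ Wt.sp2 Z, ∀ τ : TDom 4 (L * N') → ℂ, (∀ j, τ j ∈ Uτ) →
      SepHolOn Uσ (fun σ => core214 (fun σ => (𝒦 Z t).A2 σ (uOf Z t φ)) (Γm Z t φ)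
        (F214 t.2.card (χY₀ Z t) (χcP Z t) (Dfam Z t) (Vr Z t φ)) σ τ))
    (hΨτ : ∀ Z, ∀ t ∈ terms L M₃ Z, ∀ φ ∈ Wt.sp2 Z, ∀ σ : TPt 4 N' → ℂ, (∀ j, σ j ∈ Uσ) →
      SepHolOn Uτ (fun τ => core214 (fun σ => (𝒦 Z t).A2 σ (uOf Z t φ)) (Γm Z t φ)
        (F214 t.2.card (χY₀ Z t) (χcP Z t) (Dfam Z t) (Vr Z t φ)) σ τ))
    -- (3) NODE A's structural inputs at the configuration: A(σ) symmetric with Re ≻ 0 on the polydisc; Γ(σ) = G(σ)·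
    (hAs : ∀ Z, ∀ t ∈ terms L M₃ Z, ∀ φ ∈ Wt.sp2 Z, ∀ σ : TPt 4 N' → ℂ, (∀ j, ‖σ j‖ ≤ Real.exp c.κ₁) →
      ((𝒦 Z t).A2 σ (uOf Z t φ)).IsSymm)
    (hA : ∀ Z, ∀ t ∈ terms L M₃ Z, ∀ φ ∈ Wt.sp2 Z, ∀ σ : TPt 4 N' → ℂ, (∀ j, ‖σ j‖ ≤ Real.exp c.κ₁) →
      (((𝒦 Z t).A2 σ (uOf Z t φ)).map Complex.re).PosDef)
    (hlin : ∀ Z, ∀ t ∈ terms L M₃ Z, ∀ φ ∈ Wt.sp2 Z, ∀ σ : TPt 4 N' → ℂ, (∀ j, ‖σ j‖ ≤ Real.exp c.κ₁) →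
      ∀ X : (𝒦 Z t).Λ ⊕ (𝒦 Z t).C₀ → ℝ, Γm Z t φ σ X = (𝒦 Z t).G2 σ (uOf Z t φ) *ᵥ fun j => (X j : ℂ))
    {γ₂ : ℝ} (hγ₂ : 0 ≤ γ₂)
    -- (3) uniform fibre bounds of the bond locations
    {m : ℕ}
    (hfibΛ : ∀ Z t (x : UT Nf), (Finset.univ.filter fun i => (𝒦 Z t).locΛ i = x).card ≤ m)
    (hfibN : ∀ Z t (x : UT Nf), (Finset.univ.filter fun j => (𝒦 Z t).locN j = x).card ≤ m)
    -- (3) THE W-WALKS RUNG ON THE TERMS OF THE STEP (the displayed hypothesis): ONE package, a rate book, round letters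
    (q : WalkPackage) (hq : q.Admissible) (rb : RateBook q) (hκC : 0 < rb.κC) (hκCρ : rb.κC ≤ rb.ρ') (hαR : α < q.R)
    (hwalks : ∀ Z, ∀ t ∈ terms L M₃ Z, TermWalks (𝒦 Z t) q)
    {KG KCs θ₀ : ℝ} (hKG : q.Kbar ≤ KG) (hKCs : 4 / q.mA ≤ KCs)
    (hθ : 2 * q.Kbar * (Real.exp (-((rb.ρ' - rb.κC) * q.Rσ)) + α / q.R) ≤ θ₀)
    -- (3) rates below the rung's κ_C, and NODE A's letter ϑ (θ_Γ = θ_E = θ₀, K_Γ = K_G, K₀′ = K_Cs, θ_C derived)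
    {kap kap' kap'' kap₂ ϑ : ℝ} (hkap'' : 0 < kap'') (hk1 : kap'' < kap') (hk2 : kap' < kap) (hk3 : kap < kap₂)
    (hk4 : kap₂ < rb.κC) (hθ₀le : θ₀ ≤ ϑ)
    (hθR1le : (m * (1 + 2 / (kap - kap')) ^ ν) * (m * (1 + 2 / (kap' - kap'')) ^ ν)
      * (θ₀ * KCs * KG
        + KG * (KCs * θ₀ * (m * (1 + 2 / (rb.κC - kap₂)) ^ ν) * KCs * (m * (1 + 2 / (kap₂ - kap)) ^ ν)) * KG
        + KG * KCs * θ₀) ≤ ϑ)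
    (hsmallKθ : KCs * (m * (1 + 2 / kap) ^ ν) * (ϑ * (m * (1 + 2 / kap'') ^ ν)) < 1)
    -- (3) the (2.24)–(2.25) smallness with `a₂₀ = m′·α₄·M⁻⁴(1 + 32/(κ₁−1))⁴`, norms of C and Γ₀
    {cE gq : ℝ} (hc0 : 0 ≤ cE)
    (hcE : ∀ Z, ∀ t ∈ terms L M₃ Z, ∀ i, (𝒦 Z t).hC.1.eigenvalues i ≤ cE)
    (hαc : (2 * (ϑ * (m * (1 + 2 / kap'') ^ ν)) +
      (γ₂ + m' * c.α₄ * (c.M ^ 4)⁻¹ * (1 + 32 / (c.κ₁ - 1)) ^ 4)) * cE ≤ 1 / 2) (hgq : 0 ≤ gq)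
    (hΓq : ∀ Z, ∀ t ∈ terms L M₃ Z, ∀ X : (𝒦 Z t).Λ ⊕ (𝒦 Z t).C₀ → ℝ,
      ((𝒦 Z t).Γ₀ *ᵥ X) ⬝ᵥ ((𝒦 Z t).C *ᵥ ((𝒦 Z t).Γ₀ *ᵥ X)) ≤ gq * (X ⬝ᵥ X))
    (hsmall : (2 * (ϑ * (m * (1 + 2 / kap'') ^ ν)) +
      (γ₂ + m' * c.α₄ * (c.M ^ 4)⁻¹ * (1 + 32 / (c.κ₁ - 1)) ^ 4)) * (1 + 2 * cE * gq) ≤ 1 / 2)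
    -- (3) constant matching, p. 17: `a ≤ γ₂ r_P²` and the volume factor with `w = K₀(64,8)·α₄·#(⋃𝐃)`
    (hPa : a ≤ γ₂ * rP ^ 2)
    (hvol : ∀ Z, ∀ t ∈ terms L M₃ Z,
      2 * (KCs * (m * (1 + 2 / kap) ^ ν) * (ϑ * (m * (1 + 2 / kap'') ^ ν))
              * (1 + (1 - KCs * (m * (1 + 2 / kap) ^ ν) * (ϑ * (m * (1 + 2 / kap'') ^ ν)))⁻¹) / 2)
          * (Fintype.card (𝒦 Z t).Λ : ℝ)
        + K₀ 64 8 * c.α₄ * ((((Dfam Z t).image Subtype.val).biUnion id).card : ℝ)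
        + (2 * (ϑ * (m * (1 + 2 / kap'') ^ ν)) +
            (γ₂ + m' * c.α₄ * (c.M ^ 4)⁻¹ * (1 + 32 / (c.κ₁ - 1)) ^ 4)) * cE * (Fintype.card (𝒦 Z t).Λ : ℝ)
        + (2 * (ϑ * (m * (1 + 2 / kap'') ^ ν)) +
            (γ₂ + m' * c.α₄ * (c.M ^ 4)⁻¹ * (1 + 32 / (c.κ₁ - 1)) ^ 4)) * (1 + 2 * cE * gq)
            * (Fintype.card ((𝒦 Z t).Λ ⊕ (𝒦 Z t).C₀) : ℝ)
        ≤ a₅ * ((Z.1).card : ℝ)) :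
    B13.Lemma1Printed Wt.toStepData c ∧ B13.Lemma2Printed Wt.toStepData c ∧ B13.Lemma3Printed Wt.toStepData c := by
  -- signs of the round letters and of θ₀
  have hKG0 : 0 ≤ KG := (WalkPackage.Kbar_nonneg hq).trans hKG
  have hKCs0 : 0 ≤ KCs := le_trans (by have := hq.hmA; positivity) hKCs
  have hsum : 0 ≤ Real.exp (-((rb.ρ' - rb.κC) * q.Rσ)) + α / q.R :=
    add_nonneg (Real.exp_pos _).le (div_nonneg hαnn hq.hR.le)
  have hθ₀nn : 0 ≤ θ₀ :=
    le_trans (mul_nonneg (mul_nonneg zero_le_two (WalkPackage.Kbar_nonneg hq)) hsum) hθ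
  have hkap0 : 0 ≤ kap := (hkap''.trans (hk1.trans hk2)).le
  -- per term: NODE O's (2.16)-level record from the rung, in the round letters
  have hKer : ∀ Z, ∀ t ∈ terms L M₃ Z, Kernel216 (𝒦 Z t) α rb.κC KG KCs θ₀ θ₀ := fun Z t ht =>
    kernel216_of_termWalks_le hq rb (hwalks Z t ht) hκC hκCρ hαnn hαR hKG hKCs hθ
  -- the derived covariance constant is non-negative
  have hθC : 0 ≤ KCs * θ₀ * (m * (1 + 2 / (rb.κC - kap₂)) ^ ν) * KCs * (m * (1 + 2 / (kap₂ - kap)) ^ ν) := by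
    have hd12 : 0 < rb.κC - kap₂ := sub_pos.2 hk4
    have hd2k : 0 < kap₂ - kap := sub_pos.2 hk3
    have ha : 0 ≤ (m : ℝ) * (1 + 2 / (rb.κC - kap₂)) ^ ν :=
      mul_nonneg (Nat.cast_nonneg m) (pow_nonneg (by positivity) ν)
    have hb : 0 ≤ (m : ℝ) * (1 + 2 / (kap₂ - kap)) ^ ν :=
      mul_nonneg (Nat.cast_nonneg m) (pow_nonneg (by positivity) ν)
    exact mul_nonneg (mul_nonneg (mul_nonneg (mul_nonneg hKCs0 hθ₀nn) ha) hKCs0) hb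
  exact b13Leaf_twoTorus_kernel216 Wt c k hN12 hL8 hLc S0 F Sq SX T Sc Sq' SX' T' dist h133 hS0Y hFsub hSq hScY
    hdist0 hdist hSX hSX' hX0 hAdd hZero hAnT hAnT' hK hK' hκ hδ1 hδκ hκ126 hκ126' hκ₁ hκ₁' hδ₀M hδ₀M5 hR8 hR9
    h124 h130 hθ0 hθ1 hC Gl hVpp hGlAn hGl rd e he hrd s Wf hg hK₂ hR h3 hW hKW hcard hV hQ hsp hvolk hfloor hAnP
    hG M₃ hN h12 hE hε hC₁ hα hM hτ2 hUσ hUτ hUexp hUtau hr hr' hsubτ (fun Z t => (𝒦 Z t).Λ)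
    (fun Z t => (𝒦 Z t).C₀) lZ hlZ lD hlD (fun Z t φ σ => (𝒦 Z t).A2 σ (uOf Z t φ)) Γm χY₀ χcP hχ0 hχ1 Pl
    hPcard hrP hχc Dfam Vr hH ιb hι cube hQsupp hfibc emb hBv hBv0 hVr hχsupp hΨσ hΨτ (fun Z t _ => (𝒦 Z t).C)
    (fun Z t _ => (𝒦 Z t).Γ₀) (fun Z t φ σ => (𝒦 Z t).G2 σ (uOf Z t φ)) hAs hA hlin hγ₂
    (fun Z t => (𝒦 Z t).locΛ) (fun Z t => (𝒦 Z t).locN) hfibΛ hfibN hkap'' hk1 hk2 hθ₀nn hθ₀nn hθC hKG0 hKG0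
    hKCs0 hKCs0 hθ₀le hθ₀le hθR1le
    (fun Z t ht φ hφ => localisation17a_mono_rate (hk3.trans hk4).le hKG0 hKG0 hKCs0 hKCs0
      ((hKer Z t ht).localisation17a hαnn (huα Z t ht φ hφ)))
    (fun Z t ht φ hφ => differences216_of_two c (𝒦 Z t).hC (hAs Z t ht φ hφ) (hA Z t ht φ hφ) (𝒦 Z t).locΛ
      (𝒦 Z t).locN (hfibΛ Z t) hkap0 hk3 hk4 hKCs0 hKCs0 hθ₀nn hθ₀nn
      ((hKer Z t ht).localisation17a hαnn (huα Z t ht φ hφ))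
      (fun σ hσ => (hKer Z t ht).dΓ σ hσ _ (huα Z t ht φ hφ))
      (fun σ hσ => (hKer Z t ht).dE σ hσ _ (huα Z t ht φ hφ)))
    hsmallKθ hc0 (fun Z t ht φ _ => ⟨(𝒦 Z t).hC, hcE Z t ht⟩) hαc hgq (fun Z t ht φ _ X => hΓq Z t ht X) hsmall
    hPa hvol

end Walks

/-! ## §3. The FAN-OUT s3 shape: the leaf triple FROM `UniformWalksAcross 𝓣 q` for any family listing the step's terms -/

section Across

variable {L : ℕ} [NeZero L]

open Matrix

open Classical in
/-- **N10's LEAF TRIPLE ON THE TWO-SCALE TORUS FROM THE DISPLAYED HYPOTHESIS `UniformWalksAcross 𝓣 q`** — node N10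
([Balaban1988RG2Cluster] Lemmas 1–3) CLOSED MODULO NODE A's ONE Prop, ∀-generically over the family (cell FAN-OUT v1.1
§N10 s3).  For ANY family `𝓣 : S → TorusTerms c 4` of (2.14)-term kernel data across Bałaban's exhausting sequence
(member = scale ∕ history ∕ torus) carrying the W-walks rung `UniformWalksAcross 𝓣 q` with ONE sixteen-constant package
`q` — admissible, with positive input rates and volume rate `η ≤ etaMax q` (so that the STANDARD rate book
`WalkPackage.stdRates` applies: `κ_C = q.kapCStar`, `ρ′ = q.mu∕4`) — and any member `s₀` whose terms list the (2.14)-terms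
of a two-scale torus step `Wt : TwoTorusStep 4 L (𝓣 s₀).N′` (`idx Z t : (𝓣 s₀).ι`, read at the configuration
`uOf Z t φ`, `‖·‖ ≤ α` on `sp2 Z`): PRINT's TWO SMALLNESS THRESHOLDS for a `θ₀ > 0` — `α ≤ θ₀R∕(4K̄ + 4)` (the bigger
analyticity space, p. 15) and `R_σ ≥ log((4K̄ + 4)∕θ₀)∕(μ∕4 − κ_C⋆)` (σ-cubes far from `Z₀`, p. 13, `M` large) —
together with the binders of `b13Leaf_twoTorus_walks` (Lemma 1's data with the in-edges (1.24)∕(1.30), Lemma 2's data,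
Lemma 3's numerics, parameter domains, per-term lists ∕ characteristic functions ∕ potentials, termwise domination,
separate holomorphy, NODE A's structural inputs `hAs`∕`hA`∕`hlin`, round letters `K̄ ≤ K_G`, `4∕m_A ≤ K_Cs`, the rate
chain below `κ_C⋆`, `ϑ` with `θ_C` derived, the (2.24)–(2.25) smallness and the p. 17 matching) give
`Lemma1Printed ∧ Lemma2Printed ∧ Lemma3Printed` for `Wt.toStepData`.  Proof: `exchange_of_thresholds` at the standard
rate book, `termWalks_of_uniformWalksAcross` per term, `b13Leaf_twoTorus_walks`.  The node `Dag.B13_main (leavesP w P)`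
at a NODE-00 pin of the B13 group follows by `B13NodeTorusTermwise.b13_main_of_leaf_twoTorus`.  HONEST FRAMING: the rung for BAŁABAN's
family (`UniformWalksAcross 𝓣_Bałaban q`, [13] Thm 3.10 k-uniform at complex backgrounds = in-edge N06) is the
HYPOTHESIS; N10 is NOT discharged; count-neutral.
[cite: Balaban1988RG2Cluster, Lemmas 1–3 pp.9, 11, 20; (1.11) p.5, p.13, p.15, (2.14)–(2.26) pp.15–17; Balaban1985BackgroundPropagators, Thm 3.10 p.416] -/
theorem b13Leaf_twoTorus_uniformWalksAcross
    (c : B13.Consts) {S : Type*} (𝓣 : S → TorusTerms c 4) {q : WalkPackage} (hall : UniformWalksAcross 𝓣 q)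
    (s₀ : S) [NeZero (𝓣 s₀).N'] (Wt : TwoTorusStep 4 L (𝓣 s₀).N') (k : ℕ) (hN12 : 12 ≤ L * (𝓣 s₀).N') (hL8 : 8 ≤ c.L) (hLc : c.L = L)
    -- (1) LEMMA 1: index data of (1.33)
    (S0 : TDom 4 (L * (𝓣 s₀).N') → Finset (TPt 4 (L * (𝓣 s₀).N')))
    (F : TDom 4 (L * (𝓣 s₀).N') → TPt 4 (L * (𝓣 s₀).N') → Finset (TPt 4 (L * (𝓣 s₀).N')))
    (Sq : TDom 4 (L * (𝓣 s₀).N') → TPt 4 (L * (𝓣 s₀).N') → (j : ℕ) → Finset (TPt 4 (L ^ (k - j) * (L * (𝓣 s₀).N'))))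
    (SX : TDom 4 (L * (𝓣 s₀).N') → TPt 4 (L * (𝓣 s₀).N') → (j : ℕ) → TPt 4 (L ^ (k - j) * (L * (𝓣 s₀).N')) →
      Finset (TDom 4 (L ^ (k - j) * (L * (𝓣 s₀).N'))))
    (T : TDom 4 (L * (𝓣 s₀).N') → TPt 4 (L * (𝓣 s₀).N') → Finset (TPt 4 (L * (𝓣 s₀).N')) → (j : ℕ) →
      TPt 4 (L ^ (k - j) * (L * (𝓣 s₀).N')) → TDom 4 (L ^ (k - j) * (L * (𝓣 s₀).N')) → Wt.Φ → ℂ)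
    (Sc : TDom 4 (L * (𝓣 s₀).N') → Finset (TPt 4 (L * (𝓣 s₀).N')))
    (Sq' : TDom 4 (L * (𝓣 s₀).N') → TPt 4 (L * (𝓣 s₀).N') → (j : ℕ) → Finset (TPt 4 (L ^ (k - j) * (L * (𝓣 s₀).N'))))
    (SX' : TDom 4 (L * (𝓣 s₀).N') → TPt 4 (L * (𝓣 s₀).N') → (j : ℕ) → TPt 4 (L ^ (k - j) * (L * (𝓣 s₀).N')) →
      Finset (TDom 4 (L ^ (k - j) * (L * (𝓣 s₀).N'))))
    (T' : TDom 4 (L * (𝓣 s₀).N') → TPt 4 (L * (𝓣 s₀).N') → (j : ℕ) → TPt 4 (L ^ (k - j) * (L * (𝓣 s₀).N')) →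
      TDom 4 (L ^ (k - j) * (L * (𝓣 s₀).N')) → Wt.Φ → ℂ)
    (dist : TDom 4 (L * (𝓣 s₀).N') → TPt 4 (L * (𝓣 s₀).N') → (j : ℕ) → TPt 4 (L ^ (k - j) * (L * (𝓣 s₀).N')) → ℝ) {K K' : ℝ}
    (h133 : ∀ Y, Wt.Vp Y =
      (∑ a ∈ S0 Y, ∑ X ∈ (F Y a).powerset, ∑ j ∈ Finset.range (k + 1), ∑ q ∈ Sq Y a j,
        ∑ x ∈ SX Y a j q, T Y a X j q x) +
      (∑ a ∈ Sc Y, ∑ j ∈ Finset.range (k + 1), ∑ q ∈ Sq' Y a j, ∑ x ∈ SX' Y a j q, T' Y a j q x))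
    (hS0Y : ∀ Y, ∀ a ∈ S0 Y,
      (pbox (fun i => natLift a i - (5 : ℕ)) (fun i => natLift a i + 1 + (5 : ℕ))).image (proj (L * (𝓣 s₀).N')) ⊆ Y.1)
    (hFsub : ∀ Y a, F Y a ⊆
      (pbox (fun i => natLift a i - (5 : ℕ)) (fun i => natLift a i + 1 + (5 : ℕ))).image (proj (L * (𝓣 s₀).N')) \
        (pbox (fun i => natLift a i - (4 : ℕ)) (fun i => natLift a i + 1 + (4 : ℕ))).image (proj (L * (𝓣 s₀).N')))
    (hSq : ∀ Y, ∀ a ∈ S0 Y, ∀ j, Sq Y a j ⊆ (Finset.univ : Finset (TPt 4 (L ^ (k - j) * (L * (𝓣 s₀).N')))).filter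
      (fun q => tcoarse (L ^ (k - j)) (L * (𝓣 s₀).N') q ∈
        (pbox (fun i => natLift a i - (2 : ℕ)) (fun i => natLift a i + 1 + (2 : ℕ))).image (proj (L * (𝓣 s₀).N'))))
    (hScY : ∀ Y, Sc Y ⊆ Y.1)
    (hdist0 : ∀ Y a j q, 0 ≤ c.δ₀ * dist Y a j q)
    (hdist : ∀ Y a j (n : ℕ) q, q ∉ (pbox (fun i => ((L ^ (k - j) : ℕ) : ℤ) * natLift a i - (n + 1 : ℕ))
      (fun i => ((L ^ (k - j) : ℕ) : ℤ) * natLift a i + 2 * ((L ^ (k - j) : ℕ) : ℤ) - 1 + (n + 1 : ℕ))).image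
        (proj (L ^ (k - j) * (L * (𝓣 s₀).N'))) → c.δ₀ * c.M * ((n : ℝ) + 1) ≤ c.δ₀ * dist Y a j q)
    (hSX : ∀ Y a j q, SX Y a j q ⊆ (tcubeSys 4 (L ^ (k - j) * (L * (𝓣 s₀).N'))).above q)
    (hSX' : ∀ Y a j q, SX' Y a j q ⊆ (tcubeSys 4 (L ^ (k - j) * (L * (𝓣 s₀).N'))).above q)
    (hX0 : ∀ Y, ∀ a ∈ Sc Y, ∀ j ∈ Finset.range (k + 1), ∀ q ∈ Sq' Y a j, ∀ x ∈ SX' Y a j q,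
      x.1.image (tcoarse (L ^ (k - j)) (L * (𝓣 s₀).N')) ⊆ Y.1)
    -- (1) LEMMA 1: analyticity of the terms, closure of `Analytic`
    (hAdd : ∀ (s : Set Wt.Φ) (f g : Wt.Φ → ℂ), Wt.Analytic f s → Wt.Analytic g s → Wt.Analytic (f + g) s)
    (hZero : ∀ s : Set Wt.Φ, Wt.Analytic 0 s)
    (hAnT : ∀ Y, ∀ a ∈ S0 Y, ∀ X ∈ (F Y a).powerset, ∀ j ∈ Finset.range (k + 1), ∀ q ∈ Sq Y a j,
      ∀ x ∈ SX Y a j q, Wt.Analytic (T Y a X j q x) (Wt.sp1 Y))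
    (hAnT' : ∀ Y, ∀ a ∈ Sc Y, ∀ j ∈ Finset.range (k + 1), ∀ q ∈ Sq' Y a j, ∀ x ∈ SX' Y a j q,
      Wt.Analytic (T' Y a j q x) (Wt.sp1 Y))
    -- (1) LEMMA 1: thresholds and restrictions
    (hK : 0 ≤ K) (hK' : 0 ≤ K') (hκ : 0 ≤ c.κ) (hδ1 : c.δ < 1) (hδκ : 1 ≤ c.δ * c.κ)
    (hκ126 : kappa₀ 64 8 ≤ c.κ) (hκ126' : kappa₀ 64 8 ≤ c.δ * c.κ)
    (hκ₁ : 1 + 2 * Real.log (8 * 12 ^ 3) ≤ c.κ₁) (hκ₁' : 2 + 16 * Real.log 128 ≤ c.κ₁)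
    (hδ₀M : 10 * Real.exp (-1) ≤ c.δ₀ * c.M) (hδ₀M5 : 2 * Real.log 5 ≤ c.δ₀ * c.M)
    (hR8 : (1 - c.δ) * c.κ ≤ (1 / 4) * (c.κ₁ - 1)) (hR9 : (1 - 2 * c.δ) * c.κ ≤ (1 / 16) * c.κ₁)
    -- (1) LEMMA 1: per-term (1.24), (1.30) (IN-EDGES); the constants of (1.36) with headroom (1 − θ) for the local pieces
    (h124 : ∀ Y φ, φ ∈ Wt.sp1 Y → ∀ a ∈ S0 Y, ∀ X ∈ (F Y a).powerset, ∀ j ∈ Finset.range (k + 1), ∀ q ∈ Sq Y a j,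
      ∀ x ∈ SX Y a j q,
        ‖T Y a X j q x φ‖ ≤ K * ((L : ℝ) ^ j * ((L : ℝ) ^ k)⁻¹) ^ 5 *
          Real.exp (-(c.κ₁ - 1) *
            (((Y.1 \ (pbox (fun i => natLift a i - (5 : ℕ)) (fun i => natLift a i + 1 + (5 : ℕ))).image
              (proj (L * (𝓣 s₀).N'))).card : ℝ) + X.card)) *
          Real.exp (-(c.κ * torusTreeLen x.1)))
    (h130 : ∀ Y φ, φ ∈ Wt.sp1 Y → ∀ a ∈ Sc Y, ∀ j ∈ Finset.range (k + 1), ∀ q ∈ Sq' Y a j,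
      ∀ x ∈ SX' Y a j q,
        ‖T' Y a j q x φ‖ ≤ K' * Real.exp (-(1 / 2) * (c.δ₀ * c.M) * ((L : ℝ) ^ j * ((L : ℝ) ^ k)⁻¹)⁻¹
            - (1 / 2) * c.δ₀ * dist Y a j q) *
          Real.exp (-(c.κ₁ - 1) * ((Y.1 \ x.1.image (tcoarse (L ^ (k - j)) (L * (𝓣 s₀).N'))).card : ℝ)) *
          Real.exp (-(c.κ * torusTreeLen x.1)))
    {θ : ℝ} (hθ0 : 0 ≤ θ) (hθ1 : θ < 1)
    (hC : K * K₀ 64 8 * (2 * (6 * (L : ℝ)) ^ 4) * Real.exp 1 * Real.exp ((1 / 8) * c.κ₁ * (12 ^ 4 - 1)) +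
        2 * (64 * K') * K₀ 64 8 * 1344 ≤
      (1 - θ) * (c.E₀ * c.ε₁ * c.C₁ * c.M ^ c.q * Real.exp (c.C₂ * c.κ₁)))
    -- (2) LEMMA 2 (pp. 10–11): V″_k = V′_k + the local pieces G of P^{(k)}, analytic and (1.36)-small at prefactor θ
    (Gl : TDom 4 (L * (𝓣 s₀).N') → Wt.Φ → ℂ) (hVpp : ∀ Y, Wt.Vpp Y = fun φ => Wt.Vp Y φ + Gl Y φ)
    (hGlAn : ∀ Y, Wt.Analytic (Gl Y) (Wt.sp1 Y))
    (hGl : ∀ Y φ, φ ∈ Wt.sp1 Y → ‖Gl Y φ‖ ≤ θ * (c.E₀ * c.ε₁ * c.C₁ * c.M ^ c.q * Real.exp (c.C₂ * c.κ₁)) *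
      Real.exp (-((1 - 2 * c.δ) * c.κ * (tsys 4 (L * (𝓣 s₀).N')).dj Y)))
    -- (2) LEMMA 2: the located per-term data of `B13Lemma2Torus.lemma2Printed_twoTorus'`
    {E : Type*} [NormedAddCommGroup E] [NormedSpace ℂ E]
    (rd : TDom 4 (L * (𝓣 s₀).N') → Wt.Φ → E) (e : TDom 4 (L * (𝓣 s₀).N') → Wt.Bond → E) (he : ∀ Y b, ‖e Y b‖ ≤ 1)
    (hrd : ∀ Y φ, rd Y φ = haveI := Wt.finBond; ∑ b, Wt.Bv φ b • e Y b)
    {ι₂ : Type*} (s : TDom 4 (L * (𝓣 s₀).N') → Finset ι₂) (Wf : TDom 4 (L * (𝓣 s₀).N') → ι₂ → Wt.Φ → E → ℂ) {g : ℂ} (hg : g ≠ 0)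
    {R K₂ : ℝ} {m₂ : ℕ} (hK₂ : 0 ≤ K₂) (hR : 0 < R) (h3 : 3 * c.ε₁ ≤ R)
    (hW : ∀ Y, ∀ i ∈ s Y, ∀ φ ∈ Wt.sp1 Y, AnalyticOnNhd ℂ (Wf Y i φ) (ball 0 R))
    (hKW : ∀ Y, ∀ i ∈ s Y, ∀ φ ∈ Wt.sp1 Y, ∀ z ∈ ball (0 : E) R,
      ‖Wf Y i φ z‖ ≤ K₂ * Real.exp (-(c.κ₁ - 1) * ((Y.1.card : ℝ) - 1)) * ‖z‖ ^ 3)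
    (hcard : ∀ Y, (s Y).card ≤ m₂ * Y.1.card)
    (hV : ∀ Y, Wt.V Y = fun φ => (∑ i ∈ s Y, scaled g (Wf Y i φ) (rd Y φ)) + Wt.Vpp Y φ)
    (hQ : ∀ Y φ (b b' : Wt.Bond), φ ∈ Wt.sp1 Y →
      Wt.Q Y φ b b' = 2 * ∑ i ∈ s Y, Qop (scaled g (Wf Y i φ)) (rd Y φ) (e Y b) (e Y b'))
    (hsp : ∀ Y φ, φ ∈ Wt.sp1 Y → ‖g‖ * ‖rd Y φ‖ < c.ε₁)
    (hvolk : ∀ Y, Wt.volk Y = Y.1.card)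
    (hfloor : 27 * m₂ * K₂ * Real.exp (c.κ₁ - 1) ≤ c.C₃ * c.M ^ 4 * Real.exp (c.C₂ * c.κ₁))
    (hAnP : ∀ Y, ∀ i ∈ s Y, Wt.Analytic (fun φ => scaled g (Wf Y i φ) (rd Y φ)) (Wt.sp1 Y))
    (hG : ∀ Y, Wt.GaugeInv (Wt.V Y) ∧ Wt.GaugeInv (Wt.toStepData.quadForm Y) ∧ Wt.GaugeInv (Wt.Vpp Y))
    -- (3) LEMMA 3 (pp. 14–20): the signs of (2.18)–(2.20), R12, |τ(Y)| ≥ 2, and the numerics bundle at ℓ = ½L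
    (M₃ : ℕ) [NeZero M₃] {a a₂ a₂' a₅ Aabs : ℝ} (hN : Lemma3Numerics c M₃ ((c.L : ℝ) / 2) a a₂ a₂' a₅ Aabs)
    (h12 : R12 c) (hE : 0 < c.E₀) (hε : 0 < c.ε₁) (hC₁ : 0 < c.C₁) (hα : 0 < c.α₄) (hM : 1 ≤ c.M)
    (hτ2 : c.E₀ * c.ε₁ * c.C₁ * c.α₄⁻¹ * c.M ^ c.q * Real.exp (c.C₂ * c.κ₁) ≤ 1 / 2)
    -- (3) the Cauchy radius and the parameter domains (p. 15)
    {Uσ Uτ : Set ℂ} (hUσ : IsOpen Uσ) (hUτ : IsOpen Uτ) (hUexp : Metric.closedBall (0 : ℂ) (Real.exp c.κ₁) ⊆ Uσ)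
    (hUtau : ∀ Y : TDom 4 (L * (𝓣 s₀).N'),
      Metric.closedBall (0 : ℂ) ((invTau c ((tsys 4 (L * (𝓣 s₀).N')).dj Y))⁻¹) ⊆ Uτ)
    {r : ℝ} (hr : 0 < r) (hr' : r ≤ Real.exp c.κ₁ - 1)
    (hsubτ : ∀ x ∈ Set.uIcc (0 : ℝ) 1, Metric.closedBall (x : ℂ) r ⊆ Uτ)
    -- (3) THE DICTIONARY: the (2.14)-term (𝐃, P) = t of Z ∈ 𝐃_{k+1} is the term `idx Z t` of the member `s₀` (its
    --     extra columns finite), read at the configuration `u = uOf Z t φ ∈ (𝓣 s₀).E` of `φ ∈ sp2 Z`, of size ≤ α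
    (idx : TDom 4 (𝓣 s₀).N' → Finset (TDom 4 (L * (𝓣 s₀).N')) × Finset (TBond 4 M₃ (L * (𝓣 s₀).N')) → (𝓣 s₀).ι)
    [∀ Z t, Fintype ((𝓣 s₀).𝒦 (idx Z t)).C₀] [∀ Z t, DecidableEq ((𝓣 s₀).𝒦 (idx Z t)).C₀]
    (uOf : (Z : TDom 4 (𝓣 s₀).N') → (t : Finset (TDom 4 (L * (𝓣 s₀).N')) × Finset (TBond 4 M₃ (L * (𝓣 s₀).N'))) →
      Wt.Φ → (𝓣 s₀).E)
    {α : ℝ} (hαnn : 0 ≤ α) (huα : ∀ Z, ∀ t ∈ terms L M₃ Z, ∀ φ ∈ Wt.sp2 Z, ‖uOf Z t φ‖ ≤ α)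
    -- (3) per term: parameter lists, the linear map Γ(σ), characteristic functions, potentials
    (lZ : TDom 4 (𝓣 s₀).N' → Finset (TDom 4 (L * (𝓣 s₀).N')) × Finset (TBond 4 M₃ (L * (𝓣 s₀).N')) →
      List (TPt 4 (𝓣 s₀).N'))
    (hlZ : ∀ Z, ∀ t ∈ terms L M₃ Z, (lZ Z t).Nodup ∧ (lZ Z t).toFinset = Z.1 \ tclosure L (𝓣 s₀).N' (Z0 M₃ t))
    (lD : TDom 4 (𝓣 s₀).N' → Finset (TDom 4 (L * (𝓣 s₀).N')) × Finset (TBond 4 M₃ (L * (𝓣 s₀).N')) →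
      List (TDom 4 (L * (𝓣 s₀).N')))
    (hlD : ∀ Z, ∀ t ∈ terms L M₃ Z, (lD Z t).Nodup ∧ (lD Z t).toFinset = t.1)
    (Γm : (Z : TDom 4 (𝓣 s₀).N') → (t : Finset (TDom 4 (L * (𝓣 s₀).N')) × Finset (TBond 4 M₃ (L * (𝓣 s₀).N'))) → Wt.Φ →
      (TPt 4 (𝓣 s₀).N' → ℂ) → (((𝓣 s₀).𝒦 (idx Z t)).Λ ⊕ ((𝓣 s₀).𝒦 (idx Z t)).C₀ → ℝ) → (((𝓣 s₀).𝒦 (idx Z t)).Λ → ℂ))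
    (χY₀ χcP : (Z : TDom 4 (𝓣 s₀).N') → (t : Finset (TDom 4 (L * (𝓣 s₀).N')) × Finset (TBond 4 M₃ (L * (𝓣 s₀).N'))) →
      (((𝓣 s₀).𝒦 (idx Z t)).Λ → ℝ) → ℝ)
    (hχ0 : ∀ Z t B, 0 ≤ χY₀ Z t B) (hχ1 : ∀ Z t B, χY₀ Z t B ≤ 1)
    (Pl : (Z : TDom 4 (𝓣 s₀).N') → (t : Finset (TDom 4 (L * (𝓣 s₀).N')) × Finset (TBond 4 M₃ (L * (𝓣 s₀).N'))) → Finset ((𝓣 s₀).𝒦 (idx Z t)).Λ)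
    (hPcard : ∀ Z, ∀ t ∈ terms L M₃ Z, (Pl Z t).card = t.2.card) {rP : ℝ} (hrP : 0 ≤ rP)
    (hχc : ∀ Z t B, χcP Z t B = ∏ b ∈ Pl Z t, (if rP ≤ |B b| then (1 : ℝ) else 0))
    (Dfam : TDom 4 (𝓣 s₀).N' → Finset (TDom 4 (L * (𝓣 s₀).N')) × Finset (TBond 4 M₃ (L * (𝓣 s₀).N')) → Finset (TDom 4 (L * (𝓣 s₀).N')))
    (Vr : (Z : TDom 4 (𝓣 s₀).N') → (t : Finset (TDom 4 (L * (𝓣 s₀).N')) × Finset (TBond 4 M₃ (L * (𝓣 s₀).N'))) → Wt.Φ →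
      TDom 4 (L * (𝓣 s₀).N') → (((𝓣 s₀).𝒦 (idx Z t)).Λ → ℝ) → ℂ)
    -- (3) termwise domination: ‖H(Z)‖ ≤ Σ_{(𝐃,P)} ‖(2.14)‖ on the space of p. 15 ((2.9)/(2.14))
    (hH : ∀ (Z : TDom 4 (𝓣 s₀).N') (φ : Wt.Φ), φ ∈ Wt.sp2 Z → ‖Wt.H Z φ‖ ≤
      ∑ t ∈ terms L M₃ Z, ‖term214 r (lZ Z t) (lD Z t)
        (core214 (fun σ => ((𝓣 s₀).𝒦 (idx Z t)).A2 σ (uOf Z t φ)) (Γm Z t φ)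
          (F214 t.2.card (χY₀ Z t) (χcP Z t) (Dfam Z t) (Vr Z t φ))) 0 0‖)
    -- (3) the record's objects behind the terms: bonds, cubes, the real field inside the configurations
    (ιb : (Z : TDom 4 (𝓣 s₀).N') → (t : Finset (TDom 4 (L * (𝓣 s₀).N')) × Finset (TBond 4 M₃ (L * (𝓣 s₀).N'))) → ((𝓣 s₀).𝒦 (idx Z t)).Λ → Wt.Bond)
    (hι : ∀ Z t, Function.Injective (ιb Z t)) (cube : Wt.Bond → TPt 4 (L * (𝓣 s₀).N'))
    (hQsupp : ∀ (Y : TDom 4 (L * (𝓣 s₀).N')) φ b b', Wt.Q Y φ b b' ≠ 0 → cube b ∈ Y.1 ∧ cube b' ∈ Y.1)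
    {m' : ℕ} (hfibc : ∀ Z t (x : TPt 4 (L * (𝓣 s₀).N')), (Finset.univ.filter fun j => cube (ιb Z t j) = x).card ≤ m')
    (emb : (Z : TDom 4 (𝓣 s₀).N') → (t : Finset (TDom 4 (L * (𝓣 s₀).N')) × Finset (TBond 4 M₃ (L * (𝓣 s₀).N'))) → Wt.Φ →
      (((𝓣 s₀).𝒦 (idx Z t)).Λ → ℝ) → Wt.Φ)
    (hBv : ∀ Z t φ B b, Wt.Bv (emb Z t φ B) (ιb Z t b) = (B b : ℂ))
    (hBv0 : ∀ Z t φ B b', b' ∉ Set.range (ιb Z t) → Wt.Bv (emb Z t φ B) b' = 0)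
    (hVr : ∀ Z, ∀ t ∈ terms L M₃ Z, ∀ φ ∈ Wt.sp2 Z, ∀ Y ∈ Dfam Z t, ∀ B,
      emb Z t φ B ∈ Wt.sp1 Y → Vr Z t φ Y B = Wt.V Y (emb Z t φ B))
    (hχsupp : ∀ Z, ∀ t ∈ terms L M₃ Z, ∀ φ ∈ Wt.sp2 Z, ∀ B, χY₀ Z t B ≠ 0 → ∀ Y ∈ Dfam Z t,
      emb Z t φ B ∈ Wt.sp1 Y)
    -- (3) separate holomorphy of the X-integral in (σ, τ)
    (hΨσ : ∀ Z, ∀ t ∈ terms L M₃ Z, ∀ φ ∈ Wt.sp2 Z, ∀ τ : TDom 4 (L * (𝓣 s₀).N') → ℂ, (∀ j, τ j ∈ Uτ) →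
      SepHolOn Uσ (fun σ => core214 (fun σ => ((𝓣 s₀).𝒦 (idx Z t)).A2 σ (uOf Z t φ)) (Γm Z t φ)
        (F214 t.2.card (χY₀ Z t) (χcP Z t) (Dfam Z t) (Vr Z t φ)) σ τ))
    (hΨτ : ∀ Z, ∀ t ∈ terms L M₃ Z, ∀ φ ∈ Wt.sp2 Z, ∀ σ : TPt 4 (𝓣 s₀).N' → ℂ, (∀ j, σ j ∈ Uσ) →
      SepHolOn Uτ (fun τ => core214 (fun σ => ((𝓣 s₀).𝒦 (idx Z t)).A2 σ (uOf Z t φ)) (Γm Z t φ)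
        (F214 t.2.card (χY₀ Z t) (χcP Z t) (Dfam Z t) (Vr Z t φ)) σ τ))
    -- (3) NODE A's structural inputs at the configuration: A(σ) symmetric with Re ≻ 0 on the polydisc; Γ(σ) = G(σ)·
    (hAs : ∀ Z, ∀ t ∈ terms L M₃ Z, ∀ φ ∈ Wt.sp2 Z, ∀ σ : TPt 4 (𝓣 s₀).N' → ℂ, (∀ j, ‖σ j‖ ≤ Real.exp c.κ₁) →
      (((𝓣 s₀).𝒦 (idx Z t)).A2 σ (uOf Z t φ)).IsSymm)
    (hA : ∀ Z, ∀ t ∈ terms L M₃ Z, ∀ φ ∈ Wt.sp2 Z, ∀ σ : TPt 4 (𝓣 s₀).N' → ℂ, (∀ j, ‖σ j‖ ≤ Real.exp c.κ₁) →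
      ((((𝓣 s₀).𝒦 (idx Z t)).A2 σ (uOf Z t φ)).map Complex.re).PosDef)
    (hlin : ∀ Z, ∀ t ∈ terms L M₃ Z, ∀ φ ∈ Wt.sp2 Z, ∀ σ : TPt 4 (𝓣 s₀).N' → ℂ, (∀ j, ‖σ j‖ ≤ Real.exp c.κ₁) →
      ∀ X : ((𝓣 s₀).𝒦 (idx Z t)).Λ ⊕ ((𝓣 s₀).𝒦 (idx Z t)).C₀ → ℝ, Γm Z t φ σ X = ((𝓣 s₀).𝒦 (idx Z t)).G2 σ (uOf Z t φ) *ᵥ fun j => (X j : ℂ))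
    {γ₂ : ℝ} (hγ₂ : 0 ≤ γ₂)
    -- (3) uniform fibre bounds of the bond locations
    {m : ℕ}
    (hfibΛ : ∀ Z t (x : UT (𝓣 s₀).Nf), (Finset.univ.filter fun i => ((𝓣 s₀).𝒦 (idx Z t)).locΛ i = x).card ≤ m)
    (hfibN : ∀ Z t (x : UT (𝓣 s₀).Nf), (Finset.univ.filter fun j => ((𝓣 s₀).𝒦 (idx Z t)).locN j = x).card ≤ m)
    -- (3) THE RUNG's PACKAGE: admissible with positive rates, `η ≤ etaMax` (standard rate book, `κ_C = q.kapCStar`,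
    --     `ρ′ = q.mu/4`), `α < R`, round letters, and PRINT's TWO THRESHOLDS for a `θ₀ > 0`
    (hq : q.Admissible) (hp : q.PositiveRates) (hη : q.η ≤ q.etaMax) (hαR : α < q.R)
    {KG KCs θ₀ : ℝ} (hKG : q.Kbar ≤ KG) (hKCs : 4 / q.mA ≤ KCs) (hθ₀ : 0 < θ₀)
    (hαsmall : α ≤ θ₀ * q.R / (4 * q.Kbar + 4))
    (hRσlarge : Real.log ((4 * q.Kbar + 4) / θ₀) / (q.mu / 4 - q.kapCStar) ≤ q.Rσ)
    -- (3) rates below the rung's κ_C⋆, and NODE A's letter ϑ (θ_Γ = θ_E = θ₀, K_Γ = K_G, K₀′ = K_Cs, θ_C derived)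
    {kap kap' kap'' kap₂ ϑ : ℝ} (hkap'' : 0 < kap'') (hk1 : kap'' < kap') (hk2 : kap' < kap) (hk3 : kap < kap₂)
    (hk4 : kap₂ < q.kapCStar) (hθ₀le : θ₀ ≤ ϑ)
    (hθR1le : (m * (1 + 2 / (kap - kap')) ^ (𝓣 s₀).ν) * (m * (1 + 2 / (kap' - kap'')) ^ (𝓣 s₀).ν)
      * (θ₀ * KCs * KG
        + KG * (KCs * θ₀ * (m * (1 + 2 / (q.kapCStar - kap₂)) ^ (𝓣 s₀).ν) * KCs
          * (m * (1 + 2 / (kap₂ - kap)) ^ (𝓣 s₀).ν)) * KG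
        + KG * KCs * θ₀) ≤ ϑ)
    (hsmallKθ : KCs * (m * (1 + 2 / kap) ^ (𝓣 s₀).ν) * (ϑ * (m * (1 + 2 / kap'') ^ (𝓣 s₀).ν)) < 1)
    -- (3) the (2.24)–(2.25) smallness with `a₂₀ = m′·α₄·M⁻⁴(1 + 32/(κ₁−1))⁴`, norms of C and Γ₀
    {cE gq : ℝ} (hc0 : 0 ≤ cE)
    (hcE : ∀ Z, ∀ t ∈ terms L M₃ Z, ∀ i, ((𝓣 s₀).𝒦 (idx Z t)).hC.1.eigenvalues i ≤ cE)
    (hαc : (2 * (ϑ * (m * (1 + 2 / kap'') ^ (𝓣 s₀).ν)) +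
      (γ₂ + m' * c.α₄ * (c.M ^ 4)⁻¹ * (1 + 32 / (c.κ₁ - 1)) ^ 4)) * cE ≤ 1 / 2) (hgq : 0 ≤ gq)
    (hΓq : ∀ Z, ∀ t ∈ terms L M₃ Z, ∀ X : ((𝓣 s₀).𝒦 (idx Z t)).Λ ⊕ ((𝓣 s₀).𝒦 (idx Z t)).C₀ → ℝ,
      (((𝓣 s₀).𝒦 (idx Z t)).Γ₀ *ᵥ X) ⬝ᵥ (((𝓣 s₀).𝒦 (idx Z t)).C *ᵥ (((𝓣 s₀).𝒦 (idx Z t)).Γ₀ *ᵥ X)) ≤ gq * (X ⬝ᵥ X))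
    (hsmall : (2 * (ϑ * (m * (1 + 2 / kap'') ^ (𝓣 s₀).ν)) +
      (γ₂ + m' * c.α₄ * (c.M ^ 4)⁻¹ * (1 + 32 / (c.κ₁ - 1)) ^ 4)) * (1 + 2 * cE * gq) ≤ 1 / 2)
    -- (3) constant matching, p. 17: `a ≤ γ₂ r_P²` and the volume factor with `w = K₀(64,8)·α₄·#(⋃𝐃)`
    (hPa : a ≤ γ₂ * rP ^ 2)
    (hvol : ∀ Z, ∀ t ∈ terms L M₃ Z,
      2 * (KCs * (m * (1 + 2 / kap) ^ (𝓣 s₀).ν) * (ϑ * (m * (1 + 2 / kap'') ^ (𝓣 s₀).ν))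
              * (1 + (1 - KCs * (m * (1 + 2 / kap) ^ (𝓣 s₀).ν) * (ϑ * (m * (1 + 2 / kap'') ^ (𝓣 s₀).ν)))⁻¹) / 2)
          * (Fintype.card ((𝓣 s₀).𝒦 (idx Z t)).Λ : ℝ)
        + K₀ 64 8 * c.α₄ * ((((Dfam Z t).image Subtype.val).biUnion id).card : ℝ)
        + (2 * (ϑ * (m * (1 + 2 / kap'') ^ (𝓣 s₀).ν)) +
            (γ₂ + m' * c.α₄ * (c.M ^ 4)⁻¹ * (1 + 32 / (c.κ₁ - 1)) ^ 4)) * cE * (Fintype.card ((𝓣 s₀).𝒦 (idx Z t)).Λ : ℝ)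
        + (2 * (ϑ * (m * (1 + 2 / kap'') ^ (𝓣 s₀).ν)) +
            (γ₂ + m' * c.α₄ * (c.M ^ 4)⁻¹ * (1 + 32 / (c.κ₁ - 1)) ^ 4)) * (1 + 2 * cE * gq)
            * (Fintype.card (((𝓣 s₀).𝒦 (idx Z t)).Λ ⊕ ((𝓣 s₀).𝒦 (idx Z t)).C₀) : ℝ)
        ≤ a₅ * ((Z.1).card : ℝ)) :
    B13.Lemma1Printed Wt.toStepData c ∧ B13.Lemma2Printed Wt.toStepData c ∧ B13.Lemma3Printed Wt.toStepData c := by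
  -- the standard rate book decays, and print's two thresholds give the exchange inequality
  have hpos := WalkPackage.stdRates_pos q hq hp hη
  have hθ : 2 * q.Kbar * (Real.exp (-(((q.stdRates hq hp hη).ρ' - (q.stdRates hq hp hη).κC) * q.Rσ)) + α / q.R)
      ≤ θ₀ :=
    exchange_of_thresholds hq (q.stdRates hq hp hη) hpos.2.1 hθ₀ hαsmall hRσlarge
  exact b13Leaf_twoTorus_walks Wt c k hN12 hL8 hLc S0 F Sq SX T Sc Sq' SX' T' dist h133 hS0Y hFsub hSq hScY hdist0
    hdist hSX hSX' hX0 hAdd hZero hAnT hAnT' hK hK' hκ hδ1 hδκ hκ126 hκ126' hκ₁ hκ₁' hδ₀M hδ₀M5 hR8 hR9 h124 h130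
    hθ0 hθ1 hC Gl hVpp hGlAn hGl rd e he hrd s Wf hg hK₂ hR h3 hW hKW hcard hV hQ hsp hvolk hfloor hAnP hG M₃ hN h12
    hE hε hC₁ hα hM hτ2 hUσ hUτ hUexp hUtau hr hr' hsubτ (fun Z t => (𝓣 s₀).𝒦 (idx Z t)) uOf hαnn huα lZ hlZ lD
    hlD Γm χY₀ χcP hχ0 hχ1 Pl hPcard hrP hχc Dfam Vr hH ιb hι cube hQsupp hfibc emb hBv hBv0 hVr hχsupp hΨσ hΨτ hAs
    hA hlin hγ₂ hfibΛ hfibN q hq (q.stdRates hq hp hη) hpos.1 hpos.2.1.le hαR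
    (fun Z t _ => termWalks_of_uniformWalksAcross hall s₀ (idx Z t)) hKG hKCs hθ hkap'' hk1 hk2 hk3 hk4 hθ₀le
    hθR1le hsmallKθ hc0 hcE hαc hgq hΓq hsmall hPa hvol

end Across

end Literature.MathematicalPhysics.QuantumFieldTheory.Balaban1983to89.B13NodeTorusWalks

end
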